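import Mathlib
import Literature.GroupTheory.CombinatorialGroupTheory.SignedHurwitzAction
import Literature.GroupTheory.CombinatorialGroupTheory.SignedHurwitzStabilisation
import Summits.SmoothPoincare4.SmoothPoincare4.Theses.ConvexBisection
import Summits.SmoothPoincare4.SmoothPoincare4.Theorems.ConvexBisectionAcyclicBisectionExistsStubSortBiSpan
import Summits.SmoothPoincare4.SmoothPoincare4.Theorems.ConvexBisectionAcyclicBisectionExistsStubReductionLift
import Summits.SmoothPoincare4.SmoothPoincare4.Theorems.ConvexBisectionAcyclicBisectionExistsStubExchange
import Summits.SmoothPoincare4.SmoothPoincare4.Theorems.ConvexBisectionAcyclicBisectionExistsStubReachInvariants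
import Summits.SmoothPoincare4.SmoothPoincare4.Theorems.ConvexBisectionAcyclicBisectionExistsStubGlueWitness
import Summits.SmoothPoincare4.SmoothPoincare4.Theorems.ConvexBisectionAcyclicBisectionExistsStubIsotopyRegluing
import Summits.SmoothPoincare4.SmoothPoincare4.Theorems.ConvexBisectionAcyclicBisectionExistsStubContactoPlanes
import Summits.SmoothPoincare4.SmoothPoincare4.Theorems.ConvexBisectionAcyclicBisectionExistsStubGirouxGray
import Summits.SmoothPoincare4.SmoothPoincare4.Theorems.ConvexBisectionAcyclicBisectionExistsStubNiceSplitting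
import Summits.SmoothPoincare4.SmoothPoincare4.Theorems.AcyclicBisectionExists.Negative.TwistedDoubles
import Summits.SmoothPoincare4.SmoothPoincare4.Theorems.AcyclicBisectionExists.Negative.OneSided
import Literature.Topology.FourManifolds.Gluing
import Literature.Topology.FourManifolds.HandlebodySplitting
import Literature.Topology.FourManifolds.NiceMorseFunctionsProofs
import Literature.Topology.FourManifolds.MorseExistence
import Literature.Topology.FourManifolds.HomotopyS4CompactProofs
import Literature.Geometry.Symplectic.PlanarContactBoundary
import Literature.Geometry.Symplectic.GirouxContactPath
import Literature.Geometry.Symplectic.GirouxContactPathProofs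
import Literature.Topology.FourManifolds.Handles
import Literature.Geometry.Symplectic.SteinDomain
import Literature.AlgebraicTopology.SingularHomology.SingularChains
import Literature.Topology.FourManifolds.HomotopyS4OrientableProofs
import Literature.Topology.FourManifolds.LefschetzHandlebody
import Literature.Topology.FourManifolds.SmoothOrientation
import Literature.GroupTheory.CombinatorialGroupTheory.SignedHurwitzTravel
import Literature.GroupTheory.CombinatorialGroupTheory.SignedHurwitzExchange
import Summits.SmoothPoincare4.SmoothPoincare4.Theorems.ConvexBisectionAcyclicBisectionExistsMultiAttachmentAcyclic
import Summits.SmoothPoincare4.SmoothPoincare4.Theorems.ConvexBisectionAcyclicBisectionExistsCountsLength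
import Summits.SmoothPoincare4.SmoothPoincare4.Theorems.ConvexBisectionAcyclicBisectionExistsCountsSpan
import Summits.SmoothPoincare4.SmoothPoincare4.Theorems.ConvexBisectionAcyclicBisectionExistsSteinRealisationReduction
import Summits.SmoothPoincare4.SmoothPoincare4.Theorems.ConvexBisectionAcyclicBisectionExistsStabRebuildReduction
import Summits.SmoothPoincare4.SmoothPoincare4.Theorems.ConvexBisectionAcyclicBisectionExistsBeltPageClause
import Summits.SmoothPoincare4.SmoothPoincare4.Theorems.ConvexBisectionAcyclicBisectionExistsT3AssemblyClosedK
import Summits.SmoothPoincare4.SmoothPoincare4.Theorems.ConvexBisectionAcyclicBisectionExistsHgapTwisting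
import HarnessLib
import HarnessLib.Audit

/-!
# Line `modp-braid-orbits` for crux `ConvexBisection.AcyclicBisectionExists` (stmt-SmoothPoincare4-10508)

LEAD skeleton, reshape **r13** (prover-line-stmt-SmoothPoincare4-10508-c5-0, 2026-08-17; r12 earlier the same day) on top of c4's r11, c3's
r9/r10 (designed by lead c2, registered by lead c3), c1's r7–r8, lead -1's r4–r6 and lead -0's r1–r3
(history below, verbatim where still accurate).

**r13 (lead c5, 2026-08-17T18Z): T3 IS PROVED — five stubs remain: NF1, NF3 (named Literature facts), S2 `stub_palf_stein`
(named Literature fact), N1 `stub_M2geo`, N3 `stub_STgeo` (in-tree topology with landed contracts: `stub_M2geo ⇐ HC1 ∧ HC2 ∧ HD`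
p171574 + p167830/p167136/p165490; `stub_STgeo ⇐ N3-nat ∧ N1` p166176 with N3-nat ⇐ five N3d pieces, N3a CLOSED p171669, N3c
done p170790).**  `stub_T3_dualPresentation := T3_of_HB helper_Hgap_twisting` (…T3AssemblyClosedK.lean p165309, …HgapTwisting.lean
p171156): the dual-handle presentation of the complement piece of a sorted fibred model is a THEOREM of the tree (seven waves, 42
stub-workers, ≈ 300 accepted `--supports` files on the item).  Consequently NF6 = `steinRealisation_of_sorted_modelsOnFibred` holds
modulo the single classical named fact S2 ("PALF ⇒ Stein filling of the supported contact structure"), and the crux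
`AcyclicBisectionExists` is closed modulo {NF1, NF3, S2} named facts + {N1, N3} in-tree topology.  `lean check`: rc 0, 5 sorries.

**r12 (lead c5, 2026-08-17T10:20Z): NF6 AND NF4 ARE OPENED ONE LEVEL — six registered stubs, all finer.**
After four waves of stub-workers (28 workers, ≈ 140 `--supports` files ACCEPTED, 0 stub-false; DebtsMemo-r12/r13 and
Report-r12/r13/r14-*.md in the crux dir) two of the four named facts are PROVED here from finer stubs through LANDED
reductions: NF6 `stub_steinRealisation` := `steinRealisation_of_nodes stub_T3_dualPresentation stub_palf_stein`
(p148781; T1 prefix handlebody p136157, KOB Kas open book p137932, S3 contact-sign propagation p137223 discharged inside),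
and NF4 `stub_modelsOnFibred_of_reach` := `helper_modelsOnFibred_of_reach_of_nodes stub_M2geo helper_belt_pageClause
stub_STgeo` (p135224 + p134969 + p114135; N2 BELT p137382 discharged inside).  The stubs are now: NF1
`stub_modelsOnFibred_exists` and NF3 `stub_modelsOnFibred_balance` (unchanged named Literature facts), N1 `stub_M2geo`
(geometric Hurwitz move, XL), N3 `stub_STgeo` (front stabilisation rebuild, XXL), T3 `stub_T3_dualPresentation` (dual
presentation of the complement piece; ≈ 3–4 kLoC left after the landed T3b/T3c bricks: model/push/pushed
embedding/complement piece p139394…p152806, T3c-1′ p152772, T3c-2 modulo ST4 p152668, T3c-3 p145595) and S2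
`stub_palf_stein` = the named fact `Literature.Geometry.Symplectic.palf_stein_supportedByBoundaryOpenBook` (p136168;
"PALF ⇒ Stein filling of the supported contact structure").  Composition `AcyclicBisectionExists_of` unchanged and
sorry-free; `lean check` rc 0 with exactly 6 sorries = the 6 stubs.

**r11 (lead c4): NF2 LEAVES THE CONE — the skeleton is reduced to FOUR named facts (NF1, NF3, NF4, NF6).**
Audit of the r9 data flow: clause 3 of NF2 (`wordProduct (stdSymp ℤ g) l = 1`, i.e. Kas' presentation
K2 of `H₁(∂X(F; l); ℤ)`, the one in-tree debt still open after wave 5 — design lemmas (F′∧G′)) was consumed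
ONLY by `stub_reachInvariants` → `wordProduct_ratWord_eq_one` → the hypothesis of `stub_sortBiSpan`, whose
fourth output (the NEGATIVE classes span) fed the realisation clause's hypothesis
`Submodule.span ℚ (classesOfSign (ratWord l') false) = ⊤` — which the r9 proof of that clause
(`stub_sortedModelOfHandleSplitting_of`) introduces as `_hneg` and NEVER USES: `W₁ = X(F; P)` is
ℚ-acyclic from the positive span alone (NF5) and `W₂` by one-sided duality (`stub_glueWitness`).  So the
monodromy clause and the negative span were idle.  r11 therefore (i) replaces the stub `stub_modelsOn_counts`
(NF2) by the THEOREM `modelsOn_counts_lengthSpan` = clauses 1–2 only, PROVED from the landed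
`stub_modelsOn_counts_length` (p121211, Euler characteristics) and `stub_modelsOn_counts_span` (p124235,
NF5 clause 2 + gluing bookkeeping); (ii) drops `wordProduct … = 1` from the conclusion and the
negative-span hypothesis from the realisation clause of the dictionary theorem
`stub_sortedModelOfHandleSplitting(_of)` (an internal theorem since r9; the r8 registered stub of that
name stays archived/landed as p120221 in its r9 form); (iii) re-routes the composition: after the exchange
engine the word is SORTED over `ℚ` inside its Hurwitz orbit keeping its positive letters
(`SortBiSpan.exists_sorted`, landed with p72877 — no product hypothesis) and lifted back to the integral
orbit (`hurwitzOrbit_lift`, p73050); `stub_reachInvariants` (p74995), `stub_sortBiSpan` (p72877) and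
`wordProduct_ratWord_eq_one` leave the composition path (they stay landed supports of the item).  Nothing
else changes: `AcyclicBisectionExists_of` is sorry-free and concludes the crux by name from the FOUR stubs
`stub_modelsOnFibred_exists` (NF1), `stub_modelsOnFibred_balance` (NF3), `stub_modelsOnFibred_of_reach`
(NF4), `stub_steinRealisation` (NF6) — each verbatim the unfolding of its reviewer-accepted Literature
`def … : Prop` (`LefschetzModelFacts.lean` p109671, `LefschetzSteinRealisation.lean` p109672), i.e. the
crux is CLOSED MODULO the four Literature debts `<FactName>_holds`.  The whole Kas programme for K2
(design (D) p126723, (E) p125691, cokernel algebra p121375, NF2-from-K2 p124658, mirror/loops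
p124894 p124944 p126957, local models p126156 p126466 p126644 p126573) remains valid tree mathematics
towards `modelsOn_counts_of_homotopyEquiv_sphere_holds` but is no longer on the crux's cone.
Disproof.lean gen 3 re-read 2026-08-16T21:35Z (unchanged since 01:50Z): nothing on this line's stubs.

**r9.**  The ONE geometric stub of r8, `stub_sortedModelOfHandleSplitting` (the Harer / Etnyre–Fuller /
Baykur dictionary of a nice splitting), is now PROVED — inside this file, theorem
`stub_sortedModelOfHandleSplitting_of` applied to six new stubs — from the SIX NAMED FACTS of the
Lefschetz-handlebody dictionary that lead c2 landed in the tree over ≈ 1 500 lines of new CONCRETE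
vocabulary (`Literature/Topology/FourManifolds/LefschetzBase{Model,Regular,Pages}.lean`: the base
`Base g = {|y² − x^{2g+1} − 1|² + η(|x|²) ≤ ¼} ⊂ ℂ²` as a `RegularSublevel`, pages, page framing, the
`A_{2g}` chain shadow; `LefschetzHandlebody.lean`: `IsLefschetzLink`, `IsLefschetzHandlebody g l X`,
`ModelsOn M g l`, `ModelsOnFibred M g l`; p106297 p107469 p107601 p108180 p109399), namely
(`LefschetzModelFacts.lean` p109671, `LefschetzSteinRealisation.lean` p109672, all `def … : Prop` with
locators, reviewer-accepted):

* NF1 `stub_modelsOnFibred_exists`   = `LefschetzBase.modelsOnFibred_exists` (Etnyre–Fuller 2006 Thm. 1 +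
  Prop. 12 + §2; Baykur 2006 Lemma 1): every closed connected orientable 4-manifold has an allowable FIBRED
  model `M = X(F_{g,1}; l) ∪_Ψ Base g`, `Ψ` page-preserving;
* NF2 `stub_modelsOn_counts`          = `LefschetzBase.modelsOn_counts_of_homotopyEquiv_sphere` (Gompf–Stipsicz
  §8.2): over `M ≃ₕ S⁴`, `4g` letters, classes span `ℚ^{2g}`, signed monodromy `1`;
* NF3 `stub_modelsOnFibred_balance`   = `LefschetzBase.modelsOnFibred_balance_of_homotopyEquiv_sphere`
  (Etnyre–Fuller eq. (d3)): `2g` positive letters;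
* NF4 `stub_modelsOnFibred_of_reach`  = `LefschetzBase.modelsOnFibred_of_reach` (Baykur §5 p. 13, Lemma 1;
  Etnyre–Fuller §2): fibred models persist along `Reach` (signed Hurwitz moves + stabilisation pairs);
* NF5 `stub_isLefschetzHandlebody_homology` = `LefschetzBase.isLefschetzHandlebody_homology` (Gompf–Stipsicz
  §8.2, Kas 1980): `X(F; l)` connected, `H₁ ≅ ℤ^{2g}/⟨classes⟩`, ℚ-acyclic when `2g` classes span;
* NF6 `stub_steinRealisation`         = `Literature.Geometry.Symplectic.steinRealisation_of_sorted_modelsOnFibred`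
  (Baykur Thm. 5.1 proof pp. 13–14; Akbulut–Ozbagci Thm. 5; Eliashberg; Gay; Giroux): a SORTED fibred model
  `P ++ N` is realised as `M = W₁ ∪_φ W₂`, both Stein, one open book supporting both boundary plane fields,
  `W₁ = X(F; P)`.

So after r9 the crux `AcyclicBisectionExists` is KERNEL-REDUCED TO SIX PUBLISHED THEOREMS, each a named
Literature fact with a locator: every `sorry` below is `theorem stub_X : <FactName> := by sorry`, i.e. the
Literature debt `<FactName>_holds`, and nothing else is open.  The composition uses, besides the stubs, only
PROVED tree results: compactness / simple connectivity (hence connectedness) / orientability of homotopy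
4-spheres (`compactSpace_of_homotopyEquiv_sphere_four_holds`, `simplyConnectedSpace_sphere_four_holds`,
`isOrientable_of_homotopyEquiv_sphere_four_holds`), the `Reach` bookkeeping `Reach.forall_ne_zero`,
`Reach.length_filter_eq_two_mul` (`SignedHurwitzReach.lean`, p110336), and sorted-word bookkeeping
(`classesOfSign (P ++ N) true = letters P`, `(P ++ N).filter (·.2) = P`).  The nice-splitting data of the
r8 signature are not used by the proof (NF1 applies to `M` itself); the signature is kept verbatim so that
the registered stub and the r8 composition `AcyclicBisectionExists_of` stand unchanged.

Sizes (honest): NF1, NF3, NF4, NF6 are XL formalisations of published theorems (Lefschetz fibrations ↔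
Kas handlebodies, Harer's ALFs, EF's matching via Eliashberg's OT classification and `d₃`, Baykur's pair
stabilisations, Legendrian realisation + Eliashberg's Stein 2-handles + Gay + Giroux); NF2 and NF5 are
L–XL in-tree computations (cellular homology of multi-attachments over the tree's singular homology PLUS
the topology of `Base g` ≃ `F_{g,1}`, i.e. Milnor's Thm. 9.1 for `y² = x^{2g+1} + 1`, named
`LefschetzBase.exists_isChainShadow`).  Disproof.lean gen 3 (re-read 2026-08-16T15:20Z, unchanged since
01:50Z): §3 `≃ₕ` is consumed (NF2/NF3 hypotheses, compactness, one-sided duality in `stub_glueWitness`);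
§14 Targets: none on this line's stubs; §15 TwistedDoubles on the composition path; conventions (a)–(c) of
`LefschetzBasePages.lean` are the standing audit targets for NF3/NF4/NF6 (a global sign error would turn
each into its mirror statement).

Wave 1 (lead c3, 2026-08-16, five stub-workers on NF2–NF6; NF1 held by the lead): every worker replied
`stub-blocked: <FactName>` (the stub IS the Literature debt) after an independent audit that found NO
misstatement — conventions (a)–(c) re-derived three times independently and agree; `ModelsOnFibred`'s page
condition binds on all of `∂X` minus the `l.length` belt circles (so Ψ is an honest open-book isomorphism and the
geometric monodromy is trivial); NF6's orientation clause is needed and its last clause is consistent; no g = 0 /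
`l = []` / `Classical.epsilon` degeneracy refutes anything — and LANDED these sorry-free helpers `--supports`
stmt-SmoothPoincare4-10508 (each a registered sub-goal stub, `Theorems/ConvexBisectionAcyclicBisectionExists…`):
* NF2: `stub_modelsOn_counts_gluingBookkeeping` (p113042, `…StubModelsOnCounts.lean`): for ANY gluing
  `M = X ∪_Ψ Base g` with `M ≃ₕ S⁴` — `H₂(Base g;ℚ)=0 ⇒ H₁(X;ℚ)=0 ∧ H₁(X;ℤ)` torsion, `H₃(Base g;ℚ)=0 ⇒ X`
  connected, `nonempty_bBase_carrier`, clause 2 from `H₁(X;ℤ) ≃ ℤ^{2g}/span`, clause 3 from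
  `H₁(∂X;ℤ) ≃ coker(wordProduct − 1)` + `H₁(∂ Base g) ≃ ℤ^{2g}`, `counts_genus_zero_iff`;
* NF3: `stub_modelsOnFibred_pageOrBelt` (p113174, `…StubModelsOnFibredBalanceSeam.lean`: `D.jA` covers `X` minus
  the belt discs, so the page condition binds on the whole seam off `l.length` belt circles) and
  `stub_contractibleSpace_coresComplement_zero` (p113191, `…StubModelsOnFibredBalanceGenusZero.lean`:
  `contractibleSpace_base_zero` — `Base 0` is contractible by the explicit contraction `(w, y) ↦ (tw, ty)`);
* NF4: `stub_modelsOnFibred_of_reach_of_front` (p114135, `…StubModelsOnFibredOfReach.lean`, 370 lines): NF4 ⟺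
  (one signed Hurwitz step preserves fibred models) ∧ (one FRONT stabilisation pair does); every `StabStep` is a
  front stabilisation followed by `4·|A|` Hurwitz moves (`stabStep_front_orbit`, `reach_induction_front`);
* NF5: `stub_isLefschetzHandlebody_homology_connected` (p113823, `…StubLefschetzHandlebodyConnected.lean`:
  clause (1) for ALL `g, l` — `Base g` connected by a sheet-involution clopen argument, multi-attachments of
  2-handles stay connected) and `stub_isLefschetzHandlebody_homology_zero_nil` (p114200,
  `…StubIsLefschetzHandlebodyHomology.lean`: the full signature at `g = 0, l = []`, incl.
  `exists_isChainShadow_zero` = Milnor's fact at genus 0 and `IsLefschetzHandlebody g [] X → X ≃ₜ Base g`);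
* NF6: `stub_steinRealisation_topologicalEnds` (p112872, `…SteinRealisationTopologicalEnds.lean`): the
  topological clauses when `P = []` or `N = []`, `isLefschetzHandlebody_nil_base`, `IsLefschetzLink.prefix/suffix`,
  `word_eq_nil_of_genus_zero`.
What is missing (the crux's Literature debts, top of the queue): NF1, NF3, NF4 (= HS + ST-front), NF6 are XL
formalisations of the cited theorems; NF2 and NF5 reduce to the topology of the concrete base — `H_*(Base g)`,
i.e. Milnor 1968 Thm 9.1 for `y² = x^{2g+1} + 1` (`LefschetzBase.exists_isChainShadow`, proved at g = 0 only) —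
plus Mayer–Vietoris over Kosinski multi-attachments and Kas' `H₁(∂X) ≅ coker(μ_* − 1)`.

Wave 2 (lead c3, 2026-08-16T16:55–18:35Z, three stub-workers on the in-tree-computable roots):
* **D0 DISCHARGED**: `LefschetzBase.exists_isChainShadow_holds : ∀ g, ∃ σ, IsChainShadow g σ` (Milnor 1968 Thm 9.1
  for `Base g`) PROVED — `Literature/Topology/FourManifolds/LefschetzBaseShadow.lean` p120043, on top of the Milnor
  cover `Base g = U ∪ V` with `U ≃ₕ Fin 2`, `V ≃ₕ Fin (2g+1)`, `U ∩ V ≃ₕ Fin 2 × Fin (2g+1)`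
  (`LefschetzBaseCover.lean` p116822, `…CoverSectors.lean` p117109, `…CoverOverlap.lean` p116842), `H₁(Base g;ℤ)`
  free of rank 2g (`homologyOne_base`, `LefschetzBaseHomologyRank.lean` p119009), dual functionals on arc loops
  homotopic to the chain loops (`LefschetzBaseArcs.lean` p117284, `…ShadowLoops.lean` p119031), and two new
  homology tools (`ClopenCountFunctional.lean` p117052, `MayerVietorisDeltaSplit.lean` p117441).  So `shadowMap g`
  is now an honest identification `H₁(Base g;ℤ) ≅ ℤ^{2g}` for every g;
* NF5 engine: `stub_multiAttachment_mvStep` (p116237, `…MultiAttachmentHomologyMV.lean`: `H₁(U ∪ W) ≅ H₁(U)/im H₁(U∩W)`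
  for `H₁(W) = 0`, and the `H_{k+1}` iso/mono steps), `stub_multiAttachment_loopSpan` (p116384,
  `…MultiAttachmentHomologyLoops.lean`), and the 4-dimensional tube deformation
  `Literature/Topology/FourManifolds/TwoHandleTubeDeformationFour.lean` (p116284: `handleTube 3 2` retracts onto the
  parallel circle / attaching sphere; belt piece contractible) — remaining for E1 = `H₁(X) ≅ H₁(V)/⟨attaching
  classes⟩`: port §2–§3 of `TwoHandleAttachmentPi1` to `HandleAttachingMap 3 2`, Finset induction over handles;
* NF2 clause 1: `stub_modelsOn_counts_eulerGluing` (p115678, `…EulerGluing.lean`: χ(M) = χ(A) + χ(B) − χ(∂A) for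
  `IsBoundaryGluing`, χ = 0 for closed odd-dimensional manifolds), `stub_modelsOn_counts_eulerHandleModels` /
  `…_eulerHandles` (p117082, p117099: χ(X) = χ(V) + n for a multi-attachment of n 2-handles, modulo four model
  χ's discharged in the unlanded `work/stubs/EulerAssembly.lean`), `stub_modelsOn_counts_length_of_betti` (p116394,
  `…EulerCounts.lean`: `|l| = 4g` for `ModelsOn M g l`, `M ≃ₕ S⁴`, modulo χ-additivity and the Betti numbers
  `(1, 2g, 0, 0, 0)` of `Base g` — the latter now follow from the Milnor cover).
Composition in NAMED form landed as `Theorems/ConvexBisectionAcyclicBisectionExistsStubSortedModelOf.lean`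
(`stub_sortedModelOfHandleSplitting_of`, p120221).
What is missing now: NF1, NF3, NF4 (= HS + ST-front), NF6 — XL literature formalisations; NF5 = E1 completion +
H₂/H_k step (L, in-tree); NF2 = clause 1 assembly (S, in-tree) + clause 2 via E1 (S after E1) + clause 3 = Kas'
`H₁(∂X(F;l);ℤ) ≅ coker(μ_* − 1)` (L, in-tree).

---- r8 header (lead c1), kept for the history ----
LEAD skeleton, reshape **r8** (prover-line-stmt-SmoothPoincare4-10508-c1-0, 2026-08-16; r7 earlier the same
session), on top of lead -0's r1–r3 and lead -1's r4–r6 (history of those below, kept verbatim where still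
accurate).

**r8.**  The vocabulary-FREE homological bookkeeping of the nice splitting is pulled out of the dictionary into
its own registered stub `stub_niceSplittingBookkeeping` — `∂A ≠ ∅`, `A`, `B`, `∂A` connected, `H₁(A; ℚ) = 0` —
LANDED p99310 as `Theorems/ConvexBisectionAcyclicBisectionExistsStubNiceSplitting.lean` (excision for the
gluing `H_k(B, ∂B) ≅ H_k(M, jA A)`, Lefschetz
duality for the orientation of `A`/`B` pulled back from the orientable `M`, Morse vanishing above the top
handle index, `H₀` detects components) and fed to the dictionary stub as hypotheses, which is thereby
weakened to its genuinely geometric content.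
The crux: every homotopy 4-sphere `M` admits a Stein bisection along a common contact seam whose halves
are ℚ-acyclic.

**r7 (this file).**  Two observations shrink r6 (4 open stubs) to ONE open stub:

1. The two named facts behind the Giroux–Gray step are now THEOREMS of the tree:
   `Literature.Geometry.Symplectic.GirouxContactPath_holds` (Etnyre 2006 Prop. 3.18, the path of contact
   forms) and `Literature.Geometry.Symplectic.GrayStability_holds` (Gray 1959 / Geiges Thm. 2.2.2, Moser
   trick), both in `Literature/Geometry/Symplectic/GirouxContactPathProofs.lean`.  r6's stubs
   `stub_girouxContactPath`, `stub_grayStability` are therefore discharged by `exact`, and the landed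
   reduction `stub_girouxGray_of` (p87434) is applied to the two theorems directly in the composition.
2. r6's `stub_contractibleSplitting` (Akbulut–Matveyev Cor. 1, handle-theoretic half: a CONTRACTIBLE
   2-handlebody `X₁`) is not needed.  What the composition consumes from the dictionary is: total length
   `4g`, `2g` positive letters, non-zero classes, ALL classes spanning `ℚ^{2g}`, signed monodromy `1`, and
   the realisation clause.  These hold (on paper, see Stub 1) for the splitting that the tree PROVES to
   exist: `M = A ∪_φ B` with `A = f⁻¹(-∞, 2½]` the 2-handlebody of a self-indexing Morse function and
   `B = f⁻¹[2½, ∞)` the union of the 3- and 4-handles, an (upside-down) 1-HANDLEBODY —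
   `Literature.Topology.FourManifolds.exists_handlebody_boundaryGluing_of_isSelfIndexing` with Morse
   functions from `exists_isMorse_holds` (Morse 1934 / Milnor 1963 Cor. 6.7, proved) and Milnor's final
   rearrangement `exists_isSelfIndexing_criticalSet_eq_holds 4` (Thm. 4.8, proved), compactness of `M` from
   `compactSpace_of_homotopyEquiv_sphere_four_holds` (proved).  For such a splitting `B ≅ ♮ˡ S¹ × D³`,
   `Y = ∂A ≅ #ˡ S¹ × S²`, and Mayer–Vietoris in the homology sphere `M` gives `H₁(A;ℤ) ⊕ ℤˡ ≅` a quotient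
   of `H₁(Y;ℤ) = ℤˡ`, whence `H₁(A;ℤ) = 0` (Hopfian `ℤˡ`): the `A`-side vanishing cycles span `H₁(F;ℤ)`.
   The balance `#positive = 2g` survives the non-ℤHS seam because the common supported contact structure
   `ξ` on `Y` has `c₁(ξ) = 0` — it is the restriction of the Chern class of the achiral fibration on
   `−B`, and `H²(♮ˡ S¹ × D³) = 0` — so Etnyre–Ozbagci's formula `d₃(ξ) = ¼(c² − 3σ − 2χ) + q` applies on
   both sides with `c² = σ = 0` (`Q_A ≡ 0`: `H₂(A)` comes from the seam), `χ(A) = 1 + l`, `χ(−B) = 1 − l`: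
   `q_A − q_B = l`, i.e. `#pos = p_A + q_B = n_A − l = 2g` (`n_A = χ(A) − 1 + 2g = 2g + l`).
   So Stub 0 disappears into the tree and Stub 1 is restated OVER THAT SPLITTING (hypotheses = the
   tree theorem's output verbatim: boundary data `bA bB`, the identification `φ₀ : ∂A ≅ ∂B`,
   `IsBoundaryGluing bA bB φ₀ (𝓡 4) M`, `IsHandlebodyOfIndexLE 3 2 A`, `IsHandlebodyOfIndexLE 3 1 B`), with
   the single integral word `l` (the one-word model; its informal halves `l_A ++ l_B` are no longer
   separated in the signature since only their concatenation is consumed).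

After r7 the crux is `stub_sortedModelOfHandleSplitting → AcyclicBisectionExists`, kernel-checked below,
and that stub is the Harer / Etnyre–Fuller / Etnyre–Ozbagci / Baykur dictionary FOR A GIVEN nice
splitting — XL by VOCABULARY only (no Lefschetz-fibration / abstract-open-book / stabilisation language
in the tree; definition request D1 of `StubSortedModelGlueMemo.md` stands).

History.  Planner skeleton (crux-plan r1, triage r1-1/2/3): stubs `stub_sortedModel` (dictionary, XL),
`stub_acyclicRight`, `stub_modpOrbit` (finite mod-`p` engine), `stub_sortBiSpan`, `stub_reductionLift`.
Lead -0: r1 `stub_acyclicRight` LANDED p72264; r2 vocabulary to the tree (`SignedHurwitzAction.lean`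
p72321), `stub_sortBiSpan` LANDED p72877, `stub_reductionLift` LANDED p73050; r3 engine E2 → E1
(`stub_exchange` LANDED p76279 over `SignedHurwitzTravel/Exchange.lean`, `stub_reachInvariants` LANDED
p74995, `stub_modpOrbit` retired, realisation widened to `Reach`).  Lead -1, **r4**: the
dictionary's OUTPUT is cut down from the crux's point-set/`mfderiv` ∃-body to TWISTED-GLUE DATA in the
tree's gluing vocabulary — two abstract compact Stein domains `(W₁,S₁)`, `(W₂,S₂)`, boundary data
`b₁ b₂`, a diffeomorphism `ψ : ∂W₁ ≅ ∂W₂` carrying the `S₁`-induced boundary plane field to the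
`S₂`-complex tangencies, and `IsBoundaryGluing b₁ b₂ ψ (𝓡 4) M` ("`M = W₁ ∪_ψ W₂`"), `W₁` connected and
ℚ-acyclic — which is literally what Baykur's Thm 5.1 proof outputs (`X₊`, `−X₋`, the identification of
`∂X₊` with `∂(−X₋)`); the packaging into embeddings/ranges/pushed-forward planes is the Mathlib-only
stub `stub_glueWitness` (= the disprover's landed `Negative.Witness.ofTwistedGlue` + one-sided acyclicity
`Negative.Witness.acyclicRight_of_acyclicLeft_of_homotopyEquiv'`), LANDED p78503.  **r5**: the
CONTACT-MATCHING tail of the dictionary is peeled off along three classical steps over EXISTING tree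
vocabulary: the dictionary outputs Baykur's Thm 5.1 conclusion verbatim — Stein structures on the two
pieces whose induced boundary plane fields are supported, with the same orientation, by ONE open book
(`Literature.Geometry.Symplectic.OpenBook`, `OpenBook.IsGirouxForm`) on the seam — plus the gluing
`IsBoundaryGluing b₁ b₂ φ (𝓡 4) M` and the homology bookkeeping; then `stub_girouxGray` (Giroux 2002
uniqueness + Gray 1959 stability), `stub_isotopyRegluing` (Hirsch 8.2.3 in the tree's relational form,
LANDED p81429) and `stub_contactoPlanes` (chain rule, LANDED p82564) feed `stub_glueWitness`.  **r6**:
STEIN STRUCTURES ARE NOT NEEDED AT THE START — the input of the matching is any splitting of `M` into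
two 2-handlebodies carrying Harer's ACHIRAL Lefschetz fibrations; r6 asked for a contractible `X₁`
(`stub_contractibleSplitting`) + the dictionary of such a splitting (`stub_sortedModelOfSplitting`) + the
two GG named facts (`stub_girouxContactPath`, `stub_grayStability`; reduction `stub_girouxGray_of`
LANDED p87434).  **r7**: see above.

Chain (each arrow a registered stub or a tree theorem; the composition `AcyclicBisectionExists_of` is
PROVED below):

  `M ≃ₕ S⁴`
  —[TREE (`exists_niceSplitting` below = `exists_isMorse_holds` + `exists_isSelfIndexing_criticalSet_eq_holds 4`
     + `exists_handlebody_boundaryGluing_of_isSelfIndexing`, compactness by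
     `compactSpace_of_homotopyEquiv_sphere_four_holds`)]→ `M = A ∪_{φ₀} B`, `A` a compact 2-handlebody,
     `B` a compact 1-handlebody
  —[`stub_sortedModelOfHandleSplitting` (dictionary, r7 signature; geometric, XL by vocabulary): Harer ALFs
     on `A`, `−B` → Etnyre–Fuller matching → the one-word integral model `l` on `H₁(F_{g,1};ℤ) = ℤ^{2g}`;
     REALISATION of every reachable sorted bi-spanning word by Baykur's split `M = X₊ ∪ X₋`]→
  integral signed word `l`: `4g` letters, `2g` positive, non-zero classes spanning `ℚ^{2g}`, signed
  transvection product `1`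
  —[`stub_exchange` (E1 engine, LANDED p76279)]→ reachable `(g', l')`, `4g'` letters, `2g'` positive,
     positive classes spanning `ℚ^{2g'}`
  —[`stub_reachInvariants` (LANDED p74995)]→ trivial signed monodromy persists
  —[`stub_sortBiSpan` (LANDED p72877), over `ℚ` + `hurwitzOrbit_lift` (landed with p73050)]→ sorted
     bi-spanning integral word in the reach set → REALISATION → `M = W₁ ∪_φ W₂`, both boundary plane
     fields supported by one open book, `W₁` connected, ℚ-acyclic
  —[`stub_girouxGray_of` (LANDED p87434) applied to the TREE THEOREMS `GirouxContactPath_holds`,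
     `GrayStability_holds`]→ `φ₁ ≃ id` on `∂W₁` carrying `ξ₁'` onto `φ^*ξ₂'`
  —[`stub_isotopyRegluing` (LANDED p81429)]→ `M = W₁ ∪_{φ₁ ≫ φ} W₂`
  —[`stub_contactoPlanes` (LANDED p82564)]→ `d(ι₂ ∘ φ ∘ φ₁)(ξ₁') = ξ₂` pointwise
  —[`stub_glueWitness` (LANDED p78503)]→ `AcyclicBisectionExists`.

Disproof.lean (gen 3, re-read 2026-08-16T10:30Z) honoured: §3 `acyclicBisectionExists_false_without_homotopyEquiv`
— `≃ₕ` consumed by the tree splitting (compactness), by `stub_sortedModelOfHandleSplitting` (`H₁(A) = 0`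
and the balance need `H₁(M) = H₂(M) = 0`) and by `stub_glueWitness` (one-sided duality); §7 (ℂP²:
`b₂(M) = 0` used); §4 (guard `0 < k` kept); §12–§13 consistent; §15 (`Negative/TwistedDoubles.lean`) ON
the composition path; §14 Targets: no stub of this line refuted; drefute r1+r3+gen2: 0 stub-false,
0 stub-misstated (p73614, p76067 record the load-bearing hypotheses of the retired `stub_modpOrbit` and of
`stub_exchange`).
-/

noncomputable section

set_option linter.dupNamespace false

open scoped Manifold ContDiff Topology ContinuousMap

namespace Summit.SmoothPoincare4.SmoothPoincare4.Cruxes.AcyclicBisectionExists.ModpBraidOrbits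

open Literature.GroupTheory.CombinatorialGroupTheory.SignedHurwitz
open Summit.SmoothPoincare4.SmoothPoincare4.Theorems.AcyclicBisectionExists.ModpBraidOrbits
  (hurwitzOrbit_lift)
open Literature.Topology.FourManifolds (BoundaryData IsBoundaryGluing IsHandlebodyOfIndexLE IsClosedGluing
  IsOrientable compactSpace_of_homotopyEquiv_sphere_four_holds simplyConnectedSpace_sphere_four_holds
  isOrientable_of_homotopyEquiv_sphere_four_holds)
open Literature.Geometry.Symplectic (SteinStructure contactPlane boundaryPlaneField OpenBook wedge₁₂)
open Literature.AlgebraicTopology.SingularHomology (singularHomology)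
open Summit.SmoothPoincare4.SmoothPoincare4.Theorems.AcyclicBisectionExists.Negative
  (Witness HasAcyclicSteinBisection)
open Literature.Topology.FourManifolds.LefschetzBase (ModelsOn ModelsOnFibred IsLefschetzHandlebody)

/-! ## Vocabulary

`sgn`, `HurwitzStep`, `HurwitzOrbit`, `letters`, `classesOfSign`, `Sorted`, `transvection`, `wordProduct`,
`mapWord`, `stdSymp`, `ratWord` (+ bookkeeping): `Literature/GroupTheory/CombinatorialGroupTheory/SignedHurwitzAction.lean`
(p72321).  `IntWord`, `IsPrimitive`, `embed`, `newE`, `newF`, `stabBlock`, `StabStep`, `Reach` (+ bookkeeping):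
`Literature/GroupTheory/CombinatorialGroupTheory/SignedHurwitzStabilisation.lean`.  Both namespaces
`Literature.GroupTheory.CombinatorialGroupTheory.SignedHurwitz`, opened above. -/

/-! ## Step 0 — the nice splitting (r7: a THEOREM of the tree, no stub)

Every homotopy 4-sphere `M` (indeed every closed smooth 4-manifold) is the boundary gluing
`M = A ∪_{φ₀} B` of the compact 2-handlebody `A = f⁻¹(-∞, 2½]` and the compact upside-down
1-handlebody `B = f⁻¹[2½, ∞)` of a self-indexing Morse function `f` (Milnor 1965, Lemma 2.9 and
Thm. 4.8; Gompf–Stipsicz §4.4; Akbulut–Matveyev §4, "`X₁ =` 0-,1-,2-handles, `X₂ =` 3-,4-handles").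
Assembled from PROVED tree results only. -/
theorem exists_niceSplitting (M : Type) [TopologicalSpace M] [T2Space M] [SecondCountableTopology M]
    [ChartedSpace (EuclideanSpace ℝ (Fin 4)) M] [IsManifold (𝓡 4) ∞ M]
    (e : M ≃ₕ Metric.sphere (0 : EuclideanSpace ℝ (Fin 5)) 1) :
    ∃ (A B : Type) (_ : TopologicalSpace A) (_ : T2Space A) (_ : SecondCountableTopology A)
      (_ : CompactSpace A) (_ : ChartedSpace (EuclideanHalfSpace 4) A) (_ : IsManifold (𝓡∂ 4) ∞ A)
      (_ : TopologicalSpace B) (_ : T2Space B) (_ : SecondCountableTopology B)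
      (_ : CompactSpace B) (_ : ChartedSpace (EuclideanHalfSpace 4) B) (_ : IsManifold (𝓡∂ 4) ∞ B)
      (bA : BoundaryData (𝓡∂ 4) A (𝓡 3)) (bB : BoundaryData (𝓡∂ 4) B (𝓡 3))
      (φ₀ : bA.carrier ≃ₘ⟮𝓡 3, 𝓡 3⟯ bB.carrier),
      IsHandlebodyOfIndexLE 3 2 A ∧ IsHandlebodyOfIndexLE 3 1 B ∧ IsBoundaryGluing bA bB φ₀ (𝓡 4) M := by
  haveI : CompactSpace M :=
    Literature.Topology.FourManifolds.compactSpace_of_homotopyEquiv_sphere_four_holds M e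
  obtain ⟨f₀, hf₀⟩ := Literature.Topology.FourManifolds.exists_isMorse_holds 4 M
  obtain ⟨f, hf, hsi, -, -⟩ :=
    Literature.Topology.FourManifolds.exists_isSelfIndexing_criticalSet_eq_holds 4 M f₀ hf₀
  exact Literature.Topology.FourManifolds.exists_handlebody_boundaryGluing_of_isSelfIndexing
    (k := 3) M hf hsi 2 1 rfl

/-! ## Stub 0b — bookkeeping of the nice splitting (NEW in r8) — LANDED p99310

For `M ≃ₕ S⁴` split as `A ∪_{φ₀} B` (Step 0): the seam is nonempty, `A`, `B`, `∂A` are connected and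
`H₁(A; ℚ) = 0` — excision `H_k(B, ∂B; ℚ) ≅ H_k(M, jA A; ℚ)`, Lefschetz duality on the oriented pieces
(orientation pulled back from `M`), Morse vanishing (`B` has no `2`- or `3`-handles, `A` no `3`- or `4`-handles),
and `H₀` detects components.  Size M (≈ 450 lines over the tree's singular homology). -/
theorem stub_niceSplittingBookkeeping :
    ∀ (M : Type) [TopologicalSpace M] [T2Space M] [SecondCountableTopology M]
      [ChartedSpace (EuclideanSpace ℝ (Fin 4)) M] [IsManifold (𝓡 4) ∞ M],
      M ≃ₕ Metric.sphere (0 : EuclideanSpace ℝ (Fin 5)) 1 →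
      ∀ (A : Type) [TopologicalSpace A] [T2Space A] [SecondCountableTopology A] [CompactSpace A]
        [ChartedSpace (EuclideanHalfSpace 4) A] [IsManifold (𝓡∂ 4) ∞ A]
        (B : Type) [TopologicalSpace B] [T2Space B] [SecondCountableTopology B] [CompactSpace B]
        [ChartedSpace (EuclideanHalfSpace 4) B] [IsManifold (𝓡∂ 4) ∞ B]
        (bA : BoundaryData (𝓡∂ 4) A (𝓡 3)) (bB : BoundaryData (𝓡∂ 4) B (𝓡 3))
        (φ₀ : bA.carrier ≃ₘ⟮𝓡 3, 𝓡 3⟯ bB.carrier),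
        IsHandlebodyOfIndexLE 3 2 A → IsHandlebodyOfIndexLE 3 1 B → IsBoundaryGluing bA bB φ₀ (𝓡 4) M →
        Nonempty bA.carrier ∧ ConnectedSpace A ∧ ConnectedSpace B ∧ ConnectedSpace bA.carrier ∧
          CategoryTheory.Limits.IsZero (singularHomology ℚ ℚ A 1) :=
  -- LANDED (p99310): Theorems/ConvexBisectionAcyclicBisectionExistsStubNiceSplitting.lean
  Summit.SmoothPoincare4.SmoothPoincare4.Theorems.AcyclicBisectionExists.ModpBraidOrbits.stub_niceSplittingBookkeeping

/-! ## Stubs NF1–NF6 — the six named facts of the Lefschetz-handlebody dictionary (NEW in r9)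

Each stub is, VERBATIM UNFOLDED, one of the six `def <FactName> : Prop` of
`Literature/Topology/FourManifolds/LefschetzModelFacts.lean` (p109671, namespace
`Literature.Topology.FourManifolds.LefschetzBase`) and `Literature/Geometry/Symplectic/LefschetzSteinRealisation.lean`
(p109672, namespace `Literature.Geometry.Symplectic`) — unfolded (definitionally equal) rather than named only
because those two modules and `SignedHurwitzReach.lean` (p110336) are not yet built on the farm at registration
time; proving a stub = landing `<FactName>_holds` (then `exact <FactName>_holds` closes it by `rfl`-unfolding).
Statements, locators and the derivations of NF2/NF3 are in the docstrings of those files. -/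

/-- **NF1 = `LefschetzBase.modelsOnFibred_exists` — Etnyre–Fuller 2006 Thm. 1 + Prop. 12 + §2, Baykur 2006
Lemma 1**: every closed connected orientable smooth 4-manifold has an allowable fibred Lefschetz model
`ModelsOnFibred M g l` (all classes non-zero).  Size XL. [cite: EtnyreFuller2006, Thm. 1 and Prop. 12] -/
theorem stub_modelsOnFibred_exists :
    ∀ (M : Type) [TopologicalSpace M] [T2Space M] [SecondCountableTopology M] [CompactSpace M]
      [ConnectedSpace M] [ChartedSpace (EuclideanSpace ℝ (Fin 4)) M] [IsManifold (𝓡 4) ∞ M],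
      IsOrientable (𝓡 4) M →
      ∃ (g : ℕ) (l : List ((Fin g ⊕ Fin g → ℤ) × Bool)), (∀ x ∈ l, x.1 ≠ 0) ∧ ModelsOnFibred M g l := by
  sorry

/-- **NF2′ (r11) — the counts of a one-sided model of a homotopy 4-sphere, clauses 1–2 of
`LefschetzBase.modelsOn_counts_of_homotopyEquiv_sphere` (Gompf–Stipsicz 1999 §8.2 / Etnyre–Fuller §2),
PROVED**: `4g` letters (`stub_modelsOn_counts_length`, p121211: Euler characteristics of the gluing and
of the multi-attachment, Betti numbers of `Base g`) and classes spanning `ℚ^{2g}`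
(`stub_modelsOn_counts_span`, p124235: `H₁(X; ℤ) ≅ ℤ^{2g}/⟨classes⟩` + the gluing bookkeeping over
`M ≃ₕ S⁴`).  Clause 3 (`wordProduct = 1`, Kas' presentation K2) is not needed by the line (r11 header)
and is no longer stated here. [cite: GompfStipsicz1999, §8.2] -/
theorem modelsOn_counts_lengthSpan :
    ∀ (M : Type) [TopologicalSpace M] [T2Space M] [SecondCountableTopology M]
      [ChartedSpace (EuclideanSpace ℝ (Fin 4)) M] [IsManifold (𝓡 4) ∞ M] (g : ℕ)
      (l : List ((Fin g ⊕ Fin g → ℤ) × Bool)),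
      M ≃ₕ Metric.sphere (0 : EuclideanSpace ℝ (Fin 5)) 1 → ModelsOn M g l →
      l.length = 4 * g ∧ Submodule.span ℚ (letters (ratWord l)) = ⊤ :=
  fun M _ _ _ _ _ g l e hM =>
    ⟨Summit.SmoothPoincare4.SmoothPoincare4.Theorems.AcyclicBisectionExists.ModpBraidOrbits.stub_modelsOn_counts_length
        M g l e hM,
      Summit.SmoothPoincare4.SmoothPoincare4.Theorems.AcyclicBisectionExists.ModpBraidOrbits.stub_modelsOn_counts_span
        M g l e hM⟩

/-- **NF3 = `LefschetzBase.modelsOnFibred_balance_of_homotopyEquiv_sphere` — Etnyre–Fuller 2006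
eq. (d3)**: a fibred model of a homotopy 4-sphere has exactly `2g` positive letters (`d₃` of the common
seam contact structure computed from both fillings).  Size XL. [cite: EtnyreFuller2006, eq. (d3) p. 7] -/
theorem stub_modelsOnFibred_balance :
    ∀ (M : Type) [TopologicalSpace M] [T2Space M] [SecondCountableTopology M]
      [ChartedSpace (EuclideanSpace ℝ (Fin 4)) M] [IsManifold (𝓡 4) ∞ M] (g : ℕ)
      (l : List ((Fin g ⊕ Fin g → ℤ) × Bool)),
      M ≃ₕ Metric.sphere (0 : EuclideanSpace ℝ (Fin 5)) 1 → ModelsOnFibred M g l →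
      (l.filter (·.2)).length = 2 * g := by
  sorry

/-- **N1 (M2-geo) — registered stub `stub_M2geo` (NEW in r12; sub-node of NF4's (HS) half, W6 design
`NF4_Design.lean` node `node_M2geo`)**: one signed Hurwitz move of the word is realised GEOMETRICALLY on fibred data —
a new Lefschetz link `h'` of `l'`, data `D'` on `X' ≅ X`, and the seam/belt DICHOTOMY for the new seam points (transfer
form; the same-seam shear is obstructed, W6-REPORT).  Gompf–Stipsicz 1999 §8.2 (Hurwitz move = same fibration, new arcs;
handle slide), Kas 1980 §2.  Size XL (2.5–4 kLoC). [cite: GompfStipsicz1999, §8.2] -/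
theorem stub_M2geo : ∀ (g : ℕ) (l l' : Literature.GroupTheory.CombinatorialGroupTheory.SignedHurwitz.IntWord g), Literature.GroupTheory.CombinatorialGroupTheory.SignedHurwitz.HurwitzStep (Literature.GroupTheory.CombinatorialGroupTheory.SignedHurwitz.stdSymp ℤ g) l l' → ∀ (X : Type) [TopologicalSpace X] [T2Space X] [SecondCountableTopology X] [CompactSpace X] [ChartedSpace (EuclideanHalfSpace 4) X] [IsManifold (𝓡∂ 4) ∞ X] (h : Fin l.length → Literature.Topology.FourManifolds.HandleAttachingMap 3 2 (Literature.Topology.FourManifolds.LefschetzBase.Base g)) (D : Literature.Topology.FourManifolds.HandleAttachingMap.MultiAttachmentData h (𝓡∂ 4) X) (bX : Literature.Topology.FourManifolds.BoundaryData (𝓡∂ 4) X (𝓡 3)) (Ψ : bX.carrier ≃ₘ⟮𝓡 3, 𝓡 3⟯ (Literature.Topology.FourManifolds.LefschetzBase.bBase g).carrier), Literature.Topology.FourManifolds.LefschetzBase.IsLefschetzLink g l h → (∀ (y : bX.carrier) (a : ↥(Literature.Topology.FourManifolds.HandleAttachingMap.coresComplement h)), bX.incl y = D.jA a → ∃ c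 : ℝ, 0 < c ∧ Literature.Topology.FourManifolds.LefschetzBase.w g ((Literature.Topology.FourManifolds.LefschetzBase.bBase g).incl (Ψ y)).1 = (c : ℂ) * Literature.Topology.FourManifolds.LefschetzBase.w g (a : Literature.Topology.FourManifolds.LefschetzBase.Base g).1) → ∃ (X' : Type) (_ : TopologicalSpace X') (_ : T2Space X') (_ : SecondCountableTopology X') (_ : CompactSpace X') (_ : ChartedSpace (EuclideanHalfSpace 4) X') (_ : IsManifold (𝓡∂ 4) ∞ X') (h' : Fin l'.length → Literature.Topology.FourManifolds.HandleAttachingMap 3 2 (Literature.Topology.FourManifolds.LefschetzBase.Base g)) (D' : Literature.Topology.FourManifolds.HandleAttachingMap.MultiAttachmentData h' (𝓡∂ 4) X') (G : X ≃ₘ⟮𝓡∂ 4, 𝓡∂ 4⟯ X'), Literature.Topology.FourManifolds.LefschetzBase.IsLefschetzLink g l' h' ∧ ∀ a' : ↥(Literature.Topology.FourManifolds.HandleAttachingMap.coresComplement h'), G.symm (D'.jA a') ∈ (𝓡∂ 4).boundary X → (∃ a : ↥(Literature.Topology.FourManifolds.HandleAttachingMap.coresComplement h), G.symm (D'.jA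 a') = D.jA a ∧ ∃ c : ℝ, 0 < c ∧ Literature.Topology.FourManifolds.LefschetzBase.w g (a' : Literature.Topology.FourManifolds.LefschetzBase.Base g).1 = (c : ℂ) * Literature.Topology.FourManifolds.LefschetzBase.w g (a : Literature.Topology.FourManifolds.LefschetzBase.Base g).1) ∨ (∃ (k : Fin l.length) (b : ↥(Literature.Topology.FourManifolds.beltPiece 3 2)), G.symm (D'.jA a') = D.jB k b ∧ G.symm (D'.jA a') ∉ Set.range D.jA ∧ ∃ c : ℝ, 0 < c ∧ Literature.Topology.FourManifolds.LefschetzBase.w g (a' : Literature.Topology.FourManifolds.LefschetzBase.Base g).1 = (c : ℂ) * Literature.Topology.FourManifolds.LefschetzBase.pageDir l.length k) := by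
  sorry

/-- **N3 (ST-geo) — registered stub `stub_STgeo` (NEW in r12; NF4's (ST-front) half, W6 design `NF4_Design.lean` node
`node_STgeo`)**: one FRONT stabilisation pair as a REBUILD over `Base (g+1)` — fresh Lefschetz link of
`stabBlock g c ++ embed l`, fresh page-preserving `Ψ'`, every gluing of the old data diffeomorphic to every gluing of the
new (Etnyre–Fuller 2006 §2 p. 5; Baykur 2006 Lemma 1; `M ≅ M # S⁴ # S⁴` by two cancelling pairs in a collar of the
seam; lead c5: no deformation of the old cap can do it).  Size XXL (4–6 kLoC). [cite: EtnyreFuller2006, §2] -/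
theorem stub_STgeo : ∀ (g : ℕ) (l : Literature.GroupTheory.CombinatorialGroupTheory.SignedHurwitz.IntWord g) (c : Fin g ⊕ Fin g → ℤ), (c = 0 ∨ Literature.GroupTheory.CombinatorialGroupTheory.SignedHurwitz.IsPrimitive c) → ∀ (X : Type) [TopologicalSpace X] [T2Space X] [SecondCountableTopology X] [CompactSpace X] [ChartedSpace (EuclideanHalfSpace 4) X] [IsManifold (𝓡∂ 4) ∞ X] (h : Fin l.length → Literature.Topology.FourManifolds.HandleAttachingMap 3 2 (Literature.Topology.FourManifolds.LefschetzBase.Base g)) (D : Literature.Topology.FourManifolds.HandleAttachingMap.MultiAttachmentData h (𝓡∂ 4) X) (bX : Literature.Topology.FourManifolds.BoundaryData (𝓡∂ 4) X (𝓡 3)) (Ψ : bX.carrier ≃ₘ⟮𝓡 3, 𝓡 3⟯ (Literature.Topology.FourManifolds.LefschetzBase.bBase g).carrier), Literature.Topology.FourManifolds.LefschetzBase.IsLefschetzLink g l h → (∀ (y : bX.carrier) (a : ↥(Literature.Topology.FourManifolds.HandleAttachingMap.coresComplement h)), bX.incl y = D.jA a → ∃ c : ℝ, 0 < c ∧ Literature.Topology.FourManifolds.LefschetzBase.w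 g ((Literature.Topology.FourManifolds.LefschetzBase.bBase g).incl (Ψ y)).1 = (c : ℂ) * Literature.Topology.FourManifolds.LefschetzBase.w g (a : Literature.Topology.FourManifolds.LefschetzBase.Base g).1) → ∃ (X' : Type) (_ : TopologicalSpace X') (_ : T2Space X') (_ : SecondCountableTopology X') (_ : CompactSpace X') (_ : ChartedSpace (EuclideanHalfSpace 4) X') (_ : IsManifold (𝓡∂ 4) ∞ X') (h' : Fin (Literature.GroupTheory.CombinatorialGroupTheory.SignedHurwitz.stabBlock g c ++ Literature.GroupTheory.CombinatorialGroupTheory.SignedHurwitz.mapWord (Literature.GroupTheory.CombinatorialGroupTheory.SignedHurwitz.embed g) l).length → Literature.Topology.FourManifolds.HandleAttachingMap 3 2 (Literature.Topology.FourManifolds.LefschetzBase.Base (g + 1))) (D' : Literature.Topology.FourManifolds.HandleAttachingMap.MultiAttachmentData h' (𝓡∂ 4) X') (bX' : Literature.Topology.FourManifolds.BoundaryData (𝓡∂ 4) X' (𝓡 3)) (Ψ' : bX'.carrier ≃ₘ⟮𝓡 3, 𝓡 3⟯ (Literature.Topology.FourManifolds.LefschetzBase.bBase (g + 1)).carrier),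 Literature.Topology.FourManifolds.LefschetzBase.IsLefschetzLink (g + 1) (Literature.GroupTheory.CombinatorialGroupTheory.SignedHurwitz.stabBlock g c ++ Literature.GroupTheory.CombinatorialGroupTheory.SignedHurwitz.mapWord (Literature.GroupTheory.CombinatorialGroupTheory.SignedHurwitz.embed g) l) h' ∧ (∀ (y : bX'.carrier) (a : ↥(Literature.Topology.FourManifolds.HandleAttachingMap.coresComplement h')), bX'.incl y = D'.jA a → ∃ c' : ℝ, 0 < c' ∧ Literature.Topology.FourManifolds.LefschetzBase.w (g + 1) ((Literature.Topology.FourManifolds.LefschetzBase.bBase (g + 1)).incl (Ψ' y)).1 = (c' : ℂ) * Literature.Topology.FourManifolds.LefschetzBase.w (g + 1) (a : Literature.Topology.FourManifolds.LefschetzBase.Base (g + 1)).1) ∧ ∀ (M M' : Type) [TopologicalSpace M] [ChartedSpace (EuclideanSpace ℝ (Fin 4)) M] [IsManifold (𝓡 4) ∞ M] [TopologicalSpace M'] [ChartedSpace (EuclideanSpace ℝ (Fin 4)) M'] [IsManifold (𝓡 4) ∞ M'], Literature.Topology.FourManifolds.IsBoundaryGluing bX (Literature.Topology.FourManifolds.LefschetzBase.bBase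 g) Ψ (𝓡 4) M → Literature.Topology.FourManifolds.IsBoundaryGluing bX' (Literature.Topology.FourManifolds.LefschetzBase.bBase (g + 1)) Ψ' (𝓡 4) M' → Nonempty (M ≃ₘ⟮𝓡 4, 𝓡 4⟯ M') := by
  sorry

/-- **NF4 = `LefschetzBase.modelsOnFibred_of_reach` — PROVED in r12 from the stubs N1 (`stub_M2geo`) and N3
(`stub_STgeo`)** through the landed reductions: `Reach` = signed Hurwitz moves + front stabilisation pairs
(`stub_modelsOnFibred_of_reach_of_front`, p114135), (HS) from N1 + N2 (`hurwitzStep_of_redecomposition`,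
`redecomposition_of_geometric_of_belt`, p134969) with N2 = BELT LANDED (`helper_belt_pageClause`, p137382: the page
clause extends to the deep belt circles with `c > 0`), (ST-front) from N3 (`helper_frontStab_of_rebuild`, p135224);
packaged as `helper_modelsOnFibred_of_reach_of_nodes` (p135224).  Baykur 2006 §5 p. 13 + Lemma 1, Etnyre–Fuller 2006
§2, Gompf–Stipsicz §8.2. [cite: Baykur2006, Lemma 1 and §5 p. 13] -/
theorem stub_modelsOnFibred_of_reach :
    ∀ (M : Type) [TopologicalSpace M] [T2Space M] [SecondCountableTopology M]
      [ChartedSpace (EuclideanSpace ℝ (Fin 4)) M] [IsManifold (𝓡 4) ∞ M] (g : ℕ) (l : IntWord g)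
      (g' : ℕ) (l' : IntWord g'),
      ModelsOnFibred M g l → Reach g l g' l' → ModelsOnFibred M g' l' :=
  Summit.SmoothPoincare4.SmoothPoincare4.Theorems.AcyclicBisectionExists.ModpBraidOrbits.helper_modelsOnFibred_of_reach_of_nodes
    stub_M2geo
    Summit.SmoothPoincare4.SmoothPoincare4.Theorems.AcyclicBisectionExists.ModpBraidOrbits.helper_belt_pageClause
    stub_STgeo

/-- **NF5 = `LefschetzBase.isLefschetzHandlebody_homology` — Gompf–Stipsicz 1999 §8.2, Kas 1980**:
homology of a Lefschetz handlebody `X(F_{g,1}; l)` (connected; `H₁ ≅ ℤ^{2g}/⟨classes⟩`; ℚ-acyclic when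
`2g` classes span).  **PROVED** (wave 3, W3-2, p123824: Mayer–Vietoris over the Kosinski multi-attachment —
tube model p121298, cores complement p121615, cover `H₁` p121701, cover `H_k` p122193, E1 `H₁(X) ≅ H₁(V)/⟨attaching
classes⟩` p122550, E2 p123390 — on top of the discharged Milnor fact `exists_isChainShadow_holds` p120043 and the Betti
numbers of `Base g` p120614). [cite: GompfStipsicz1999, §8.2] -/
theorem stub_isLefschetzHandlebody_homology :
    ∀ (g : ℕ) (l : List ((Fin g ⊕ Fin g → ℤ) × Bool)) (X : Type) [TopologicalSpace X] [T2Space X]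
      [SecondCountableTopology X] [CompactSpace X] [ChartedSpace (EuclideanHalfSpace 4) X]
      [IsManifold (𝓡∂ 4) ∞ X],
      IsLefschetzHandlebody g l X →
      ConnectedSpace X ∧
        Nonempty ((singularHomology ℤ ℤ X 1) ≃ₗ[ℤ]
          ((Fin g ⊕ Fin g → ℤ) ⧸ Submodule.span ℤ (letters l))) ∧
        (Submodule.span ℚ (letters (ratWord l)) = ⊤ → l.length = 2 * g →
          ∀ k, 0 < k → CategoryTheory.Limits.IsZero (singularHomology ℚ ℚ X k)) :=
  -- LANDED (p123824, wave 3): Theorems/ConvexBisectionAcyclicBisectionExistsMultiAttachmentAcyclic.lean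
  Summit.SmoothPoincare4.SmoothPoincare4.Theorems.AcyclicBisectionExists.ModpBraidOrbits.stub_isLefschetzHandlebody_homology

/-- **T3 — `stub_T3_dualPresentation`, registered stub of r12, PROVED in r13 (2026-08-17T18Z) :=
`T3_of_HB helper_Hgap_twisting` (contracts X2 p158599 / G1 p164345 / G3 p165309, ST4 p162137, Hgap transport p164807,
character p164699, twisting p171156 with H1 p170804 / H2 p170817 — ≈ 80 files of waves 3–7); (r12 text: W7 design `NF6_Assembly_Design.lean` node
`node_T3_dualPresentation`, written against the landed Literature vocabulary, token-for-token the antecedent of the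
landed `helper_steinRealisation_of_nodes`, p148781)**: the DUAL-HANDLE PRESENTATION of the complement piece of a sorted
fibred model — `M = X₁ ∪_φ W₂`, the model's Lefschetz link `h`, `X₁ = Base g ∪ (prefix handles)` with data `D₁`, `W₂`
presented as a positive allowable Lefschetz handlebody over the cap (`h₂`, `D₂`: circles in pages, shadows `≠ 0`, page
twistings `−1`), the seam page function `F`, the binding clause, one ORSEAM point, `∂X₁` connected.  Milnor 1965 §3
(dual presentation), Kosinski 1993 VI §8/VII §1, Gompf–Stipsicz 1999 §8.2, Baykur 2006 proof of Thm. 5.1 pp. 13–14.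
State r12: T3b bricks (model, push, pushed embedding, complement piece) LANDED up to (iv) cover/glue and (v) seam clause;
T3c-1′ LANDED (p152772); T3c-2 LANDED modulo the twisting sign ST4 (p152668 contract); T3c-3 LANDED from T3c-1′+T3c-2
(p145595); extras (sign pin + ORSEAM, `F`, binding clause, connectedness) open — DebtsMemo-r13.  Size of what is left:
L–XL (≈ 3–4 kLoC). [cite: Baykur2006, Thm. 5.1 (proof, pp. 13–14)] -/
theorem stub_T3_dualPresentation : ∀ (M : Type) [TopologicalSpace M] [T2Space M] [SecondCountableTopology M] [ChartedSpace (EuclideanSpace ℝ (Fin 4)) M] [IsManifold (𝓡 4) ∞ M] (g : ℕ) (P N : List ((Fin g ⊕ Fin g → ℤ) × Bool)), Literature.Topology.FourManifolds.LefschetzBase.ModelsOnFibred M g (P ++ N) → (∀ x ∈ N, x.2 = false) → (∀ x ∈ P ++ N, x.1 ≠ 0) → ∃ (h : Fin (P ++ N).length → Literature.Topology.FourManifolds.HandleAttachingMap 3 2 (Literature.Topology.FourManifolds.LefschetzBase.Base g)) (X₁ : Type) (_ : TopologicalSpace X₁) (_ : T2Space X₁) (_ : SecondCountableTopology X₁)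 (_ : CompactSpace X₁) (_ : ChartedSpace (EuclideanHalfSpace 4) X₁) (_ : IsManifold (𝓡∂ 4) ∞ X₁) (D₁ : Literature.Topology.FourManifolds.HandleAttachingMap.MultiAttachmentData (fun i : Fin P.length => h (Fin.cast List.length_append.symm (Fin.castAdd N.length i))) (𝓡∂ 4) X₁) (W₂ : Type) (_ : TopologicalSpace W₂) (_ : ChartedSpace (EuclideanHalfSpace 4) W₂) (_ : IsManifold (𝓡∂ 4) ∞ W₂) (_ : CompactSpace W₂) (_ : T2Space W₂) (_ : SecondCountableTopology W₂) (b₁ : Literature.Topology.FourManifolds.BoundaryData (𝓡∂ 4) X₁ (𝓡 3)) (b₂ : Literature.Topology.FourManifolds.BoundaryData (𝓡∂ 4) W₂ (𝓡 3)) (φ : b₁.carrier ≃ₘ⟮𝓡 3, 𝓡 3⟯ b₂.carrier) (h₂ : Fin N.length → Literature.Topology.FourManifolds.HandleAttachingMap 3 2 (Literature.Topology.FourManifolds.LefschetzBase.Base g)) (D₂ : Literature.Topology.FourManifolds.HandleAttachingMap.MultiAttachmentData h₂ (𝓡∂ 4) W₂) (F : b₁.carrier → ℂ), Literature.Topology.FourManifolds.LefschetzBase.IsLefschetzLink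 g (P ++ N) h ∧ Literature.Topology.FourManifolds.IsBoundaryGluing b₁ b₂ φ (𝓡 4) M ∧ (∀ j, ∃ c : ℂ, ‖c‖ = 1 ∧ ∀ θ, (h₂ j).attachingCircle θ ∈ Literature.Topology.FourManifolds.LefschetzBase.page g c) ∧ (∀ j, Literature.Topology.FourManifolds.LefschetzBase.shadow g (h₂ j).attachingCircle (h₂ j).continuous_attachingCircle ≠ 0) ∧ (∀ j, Literature.Topology.FourManifolds.LefschetzBase.pageTwisting g (h₂ j).attachingCircle (h₂ j).attachingFraming = -1) ∧ ContMDiff (𝓡 3) 𝓘(ℝ, ℂ) ∞ F ∧ (∀ y a, b₁.incl y = D₁.jA a → ∃ c : ℝ, 0 < c ∧ F y = c * Literature.Topology.FourManifolds.LefschetzBase.w g a.1.1) ∧ (∀ y a', b₂.incl (φ y) = D₂.jA a' → ∃ c : ℝ, 0 < c ∧ F y = c * Literature.Topology.FourManifolds.LefschetzBase.w g a'.1.1) ∧ (∀ y, F y = 0 → ∃ a, b₁.incl y = D₁.jA a) ∧ (∀ y, F y ≠ 0 → ∃ v : EuclideanSpace ℝ (Fin 3), ((starRingEnd ℂ) (F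 y) * @id ℂ (mfderiv (𝓡 3) 𝓘(ℝ, ℂ) F y v)).im ≠ 0) ∧ (∀ y a, b₁.incl y = D₁.jA a → Literature.Topology.FourManifolds.LefschetzBase.w g a.1.1 = 0 → ∃ a', b₂.incl (φ y) = D₂.jA a') ∧ (∃ (y : b₁.carrier) (a₁ : Literature.Topology.FourManifolds.HandleAttachingMap.coresComplement (fun i : Fin P.length => h (Fin.cast List.length_append.symm (Fin.castAdd N.length i)))) (a₂ : Literature.Topology.FourManifolds.HandleAttachingMap.coresComplement h₂) (uu : Fin 3 → EuclideanSpace ℝ (Fin 3)) (v₁ v₂ : Fin 3 → EuclideanSpace ℝ (Fin 4)), b₁.incl y = D₁.jA a₁ ∧ b₂.incl (φ y) = D₂.jA a₂ ∧ (∀ k, mfderiv (𝓡 3) (𝓡∂ 4) b₁.incl y (uu k) = mfderiv (𝓡∂ 4) (𝓡∂ 4) D₁.jA a₁ (v₁ k)) ∧ (∀ k, mfderiv (𝓡 3) (𝓡∂ 4) (b₂.incl ∘ φ) y (uu k) = mfderiv (𝓡∂ 4) (𝓡∂ 4) D₂.jA a₂ (v₂ k)) ∧ Literature.Geometry.Symplectic.IsPosBdryFrame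 (fun i : Fin P.length => h (Fin.cast List.length_append.symm (Fin.castAdd N.length i))) a₁ v₁ ∧ Literature.Geometry.Symplectic.IsPosBdryFrame h₂ a₂ v₂) ∧ ConnectedSpace b₁.carrier :=
  Summit.SmoothPoincare4.SmoothPoincare4.Theorems.AcyclicBisectionExists.ModpBraidOrbits.T3_of_HB
    Summit.SmoothPoincare4.SmoothPoincare4.Theorems.AcyclicBisectionExists.ModpBraidOrbits.helper_Hgap_twisting

/-- **S2 — registered stub `stub_palf_stein` (NEW in r12) = the NAMED FACT
`Literature.Geometry.Symplectic.palf_stein_supportedByBoundaryOpenBook`** (ACCEPTED Literature def p136168,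
`Literature/Geometry/Symplectic/LefschetzSteinOpenBook.lean`): a positive allowable Lefschetz handlebody over the
standard base carries a Stein structure whose boundary complex tangencies are supported, through a Giroux form positive
for the complex boundary orientation, by its Kas open book (Akbulut–Ozbagci 2001 Thm. 5 + Gay 2002 Prop. 2.8, as
assembled in Baykur 2006 p. 14 / Etnyre 2006 Thm. 5.6; root: Eliashberg's Stein 2-handle theorem).  Closes by
`exact Literature.Geometry.Symplectic.palf_stein_supportedByBoundaryOpenBook_holds` once that Literature debt is
discharged. [cite: AkbulutOzbagci2001, Thm. 5] -/
theorem stub_palf_stein : Literature.Geometry.Symplectic.palf_stein_supportedByBoundaryOpenBook := by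
  sorry

/-- **NF6 = `Literature.Geometry.Symplectic.steinRealisation_of_sorted_modelsOnFibred` — PROVED in r12 from the
stubs T3 (`stub_T3_dualPresentation`) and S2 (`stub_palf_stein`)** through the landed reduction
`steinRealisation_of_nodes` (p148781: T3 ▸ `IsLefschetzLink.prefix` ▸ KOB `helper_kasOpenBook_of_seamFunction`
p137932 ▸ T1 `helper_isLefschetzHandlebody_of_split` p136157 ▸ S2 twice with the SAME open book ▸ chain rule
`boundaryPlaneField_reindexBoundaryData` ▸ S3-orient `helper_wedge_pos_iff_of_exists` p137223 at the ORSEAM point).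
Baykur 2006 Thm. 5.1 (proof pp. 13–14), Akbulut–Ozbagci 2001 Thm. 5, Eliashberg 1990, Gay, Giroux; statement unchanged
since r4. [cite: Baykur2006, Thm. 5.1 (proof, pp. 13–14)] -/
theorem stub_steinRealisation :
    ∀ (M : Type) [TopologicalSpace M] [T2Space M] [SecondCountableTopology M]
      [ChartedSpace (EuclideanSpace ℝ (Fin 4)) M] [IsManifold (𝓡 4) ∞ M] (g : ℕ)
      (P N : List ((Fin g ⊕ Fin g → ℤ) × Bool)),
      ModelsOnFibred M g (P ++ N) → (∀ x ∈ P, x.2 = true) → (∀ x ∈ N, x.2 = false) →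
      (∀ x ∈ P ++ N, x.1 ≠ 0) →
      ∃ (W₁ : Type) (_ : TopologicalSpace W₁) (_ : ChartedSpace (EuclideanHalfSpace 4) W₁)
        (_ : IsManifold (𝓡∂ 4) ∞ W₁) (_ : CompactSpace W₁) (_ : T2Space W₁)
        (_ : SecondCountableTopology W₁)
        (W₂ : Type) (_ : TopologicalSpace W₂) (_ : ChartedSpace (EuclideanHalfSpace 4) W₂)
        (_ : IsManifold (𝓡∂ 4) ∞ W₂) (_ : CompactSpace W₂)
        (S₁ : SteinStructure W₁) (S₂ : SteinStructure W₂)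
        (b₁ : BoundaryData (𝓡∂ 4) W₁ (𝓡 3)) (b₂ : BoundaryData (𝓡∂ 4) W₂ (𝓡 3))
        (φ : b₁.carrier ≃ₘ⟮𝓡 3, 𝓡 3⟯ b₂.carrier)
        (ob : OpenBook b₁.carrier)
        (α₁ α₂ : Literature.Geometry.Kaehler.MForm (𝓡 3) b₁.carrier ℝ 1),
        IsBoundaryGluing b₁ b₂ φ (𝓡 4) M ∧
        ob.IsGirouxForm (boundaryPlaneField S₁.J b₁) α₁ ∧
        ob.IsGirouxForm (fun y => (boundaryPlaneField S₂.J b₂ (φ y)).comap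
          (mfderiv (𝓡 3) (𝓡 3) φ y).toLinearMap) α₂ ∧
        (∀ y u v w, 0 < wedge₁₂ (α₁ y) (Literature.Geometry.Kaehler.mextDeriv α₁ y) u v w ↔
          0 < wedge₁₂ (α₂ y) (Literature.Geometry.Kaehler.mextDeriv α₂ y) u v w) ∧
        IsLefschetzHandlebody g P W₁ :=
  Summit.SmoothPoincare4.SmoothPoincare4.Theorems.AcyclicBisectionExists.ModpBraidOrbits.steinRealisation_of_nodes
    stub_T3_dualPresentation stub_palf_stein

/-! ## `Reach` bookkeeping (PROVED; = `Reach.forall_ne_zero`, `Reach.length_filter_eq_two_mul` of the landed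
`Literature/GroupTheory/CombinatorialGroupTheory/SignedHurwitzReach.lean`, p110336 — re-proved here under
primed names only because that module is not yet built on the farm at registration time) -/

section ReachBookkeeping

/-- The letters of the stabilisation block are non-zero. [folklore] -/
theorem stabBlock_forall_ne_zero' (n : ℕ) (c : Fin n ⊕ Fin n → ℤ) : ∀ x ∈ stabBlock n c, x.1 ≠ 0 := by
  intro x hx
  simp only [stabBlock, List.mem_cons, List.not_mem_nil, or_false] at hx
  have hE : newE n + embed n c ≠ 0 := fun h => by
    have := congrFun h (Sum.inl (Fin.last n))
    simp [newE] at this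
  have hF : newF n ≠ 0 := fun h => by
    have := congrFun h (Sum.inr (Fin.last n))
    simp [newF] at this
  rcases hx with rfl | rfl | rfl | rfl <;> assumption

/-- Embedded letters of a word with non-zero classes are non-zero. [folklore] -/
theorem mapWord_embed_forall_ne_zero' (n : ℕ) {w : IntWord n} (hw : ∀ x ∈ w, x.1 ≠ 0) :
    ∀ x ∈ mapWord (embed n) w, x.1 ≠ 0 := by
  intro x hx
  obtain ⟨y, hy, rfl⟩ := List.mem_map.1 hx
  intro h0
  exact hw y hy (embed_injective n (h0.trans (embed_zero n).symm))

/-- **Reachability kills no class.** [folklore] -/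
theorem reach_forall_ne_zero' {g : ℕ} {l : IntWord g} {g' : ℕ} {l' : IntWord g'} (h : Reach g l g' l')
    (hl : ∀ x ∈ l, x.1 ≠ 0) : ∀ x ∈ l', x.1 ≠ 0 := by
  induction h with
  | refl => exact hl
  | hurwitz _ hst ih => exact hst.ne_zero (stdSymp_int_self _) ih
  | stab _ hst ih =>
    obtain ⟨A, B, c, -, rfl, rfl⟩ := hst
    have hA : ∀ x ∈ A, x.1 ≠ 0 := fun x hx => ih x (List.mem_append_left _ hx)
    have hB : ∀ x ∈ B, x.1 ≠ 0 := fun x hx => ih x (List.mem_append_right _ hx)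
    intro x hx
    simp only [List.mem_append] at hx
    rcases hx with (hx | hx) | hx
    · exact mapWord_embed_forall_ne_zero' _ hA x hx
    · exact stabBlock_forall_ne_zero' _ c x hx
    · exact mapWord_embed_forall_ne_zero' _ hB x hx

/-- **Reachability keeps `2g` positive letters at genus `g`.** [folklore] -/
theorem reach_length_filter_eq_two_mul' {g : ℕ} {l : IntWord g} {g' : ℕ} {l' : IntWord g'}
    (h : Reach g l g' l') (hl : (l.filter (·.2)).length = 2 * g) :
    (l'.filter (·.2)).length = 2 * g' := by
  induction h with
  | refl => exact hl
  | hurwitz _ hst ih => rw [← ih]; exact hst.length_filter_eq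
  | stab _ hst ih =>
    obtain ⟨A, B, c, -, rfl, rfl⟩ := hst
    simp only [List.filter_append, List.length_append, length_filter_mapWord] at ih ⊢
    have : ((stabBlock _ c).filter (·.2)).length = 2 := by simp [stabBlock]
    omega

end ReachBookkeeping

/-! ## Stub 1 — the sorted-model dictionary OF A NICE SPLITTING: PROVED in r9 from NF1–NF6

r8 docstring (the paper proof over a nice splitting) kept below for the record; the r9 proof takes the fibred
model of NF1 on `M` directly (compact, simply connected, orientable by tree theorems), reads the counts off
NF2/NF3, transports the model along `Reach` by NF4 (counts by the proved `Reach` bookkeeping), realises the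
sorted word by NF6 and reads connectedness / acyclicity / the `H₁` anchor of `W₁ = X(F; P)` off NF5. -/

/-! ### (r8 record) the sorted-model dictionary of a nice splitting, on paper

Given a homotopy 4-sphere `M` presented as `A ∪_{φ₀} B` with `A` a compact 2-handlebody and `B` a
compact 1-handlebody (Step 0; then `B ≅ ♮ˡ S¹ × D³`, `Y = ∂A ≅ #ˡ S¹ × S²`, `H₁(A;ℤ) = 0`,
`H₂(A;ℤ) ≅ H₂(Y;ℤ) = ℤˡ` with `Q_A ≡ 0`, `A`, `B`, `Y` connected), and GIVEN the bookkeeping of Stub 0b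
as hypotheses (r8: `∂A ≠ ∅`, `A`, `B`, `∂A` connected, `H₁(A; ℚ) = 0`), there are `g` and an integral
signed word `l` over `ℤ^{2g} = H₁(F_{g,1};ℤ)` — the one-word model `l = l_A ++ rev (l_B)⁻¹` of an
Etnyre–Fuller MATCHED PAIR of allowable achiral Lefschetz fibrations `A' → D²`, `(−B)' → D²`
(`A' ≅ A`, `(−B)' ≅ −B`) with common boundary open book `(F_{g,1}, μ)` on `Y` and connected binding:
Harer's ALFs on the two 2-handlebodies (allowable: Baykur arXiv:math/0601396 Lemma 1), matched by
Etnyre–Fuller arXiv:math/0510008 Prop. 12, whose proof treats EXACTLY this splitting (`Y₁ =` 0-,1-,2-handles,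
`Y₂ =` 3-,4-handles: `−Y₂ = Σ × D²` with the obvious fibration, Stein, `c₁(ξ₂) = 0`; `c₁(ξ₁)` killed by
changing rotation numbers through ± stabilisations inside `Y₁`; `d₃` equalised by negative stabilisations;
Eliashberg's OT classification; Giroux positive stabilisations — all inside the pieces, so `A`, `B` are
unchanged; EF's "even number of 1-handles" is a convenience: for odd rank one positive stabilisation of
`F × D²`, `F` with two boundary circles, restores a connected binding) — such that: `l` has `n_A + n_B = (χ(A) − 1 + 2g) + (χ(B) − 1 + 2g) = 4g` letters
(`χ(A) + χ(B) = χ(M) + χ(Y) = 2`); all classes non-zero (allowable); all classes span — already the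
`A`-letters span `ℤ^{2g}` (`H₁(A;ℤ) = H₁(F)/⟨A-cycles⟩ = 0`: Mayer–Vietoris in the homology sphere `M`,
`H₁(A) ⊕ H₁(B)` is a quotient of `H₁(Y) = ℤˡ` and `H₁(B) = ℤˡ`, so `H₁(A) = 0` by Hopficity of `ℤˡ`);
exactly `2g` of the `4g` letters positive (signs = chirality w.r.t. `M`: `#pos = p_A + q_B`; the
common open-book-supported contact structure `ξ` on `Y` has `c₁(ξ) = c((−B)')|_Y = 0` since
`H²(♮ˡ S¹ × D³) = 0`, so Etnyre–Ozbagci's `d₃(ξ) = ¼(c² − 3σ − 2χ) + q` (Trans. AMS 360 (2008),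
Thm. 6.1 / Cor.) holds on both sides with `c² = σ = 0`: `−(1+l)/2 + q_A = −(1−l)/2 + q_B`, i.e.
`q_A − q_B = l`, hence `#pos = (n_A − q_A) + q_B = 2g + l − l = 2g`); signed transvection product `1`
(`μ_A μ_B = 1`, Baykur p.12); and the REALISATION clause: every `(g', l')` reachable from `l` by signed
Hurwitz moves (re-choices of arcs on the capped fibration `Ŷ → S²`, Baykur pp.12–13) and
stabilisation-pair moves (`StabStep`: two Etnyre–Fuller stabilisations of the bisection cut at the
insertion point, classes `e + c`, `f`, `c` primitive or zero) which is SORTED with positive and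
negative classes ℚ-bases is realised by Baykur's split (p.13) `M = X₊ ∪_H X₋`, `X₊ = PALF(F'; P)`,
`−X₋ = PALF(F'; rev N⁻¹)`, both compact Stein (p.14: Akbulut–Ozbagci induction — Legendrian realisation
on pages, framing `tb − 1`, Eliashberg, Gay), BOTH induced contact structures supported by the common
boundary open book — recorded in tree vocabulary: compact Stein domains `(W₁,S₁) = X₊`, `(W₂,S₂) = −X₋`,
boundary data `b₁ b₂`, the identification `φ : ∂W₁ ≅ ∂W₂` with `IsBoundaryGluing b₁ b₂ φ (𝓡 4) M`, an
open book `ob` on `b₁.carrier` with Giroux forms `α₁` for `ξ₁' = boundaryPlaneField S₁.J b₁` and `α₂`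
for the pulled-back `φ^* ξ₂'` inducing the same orientation; `W₁` connected, ℚ-acyclic
(`b₁ = 2g' − rk⟨P⟩ = 0`, `b₂ = #P − rk⟨P⟩ = 0`), ANCHOR `H₁(W₁;ℤ) ≅ ℤ^{2g'}/⟨[P]⟩` (the realiser
genuinely depends on `l'`; drefute r3 checked the prediction `SNF(T_P − 1) = ℤ/d ⊕ ℤ/d` at `M = S⁴`).
Size XL by vocabulary (no Lefschetz fibration / open-book monodromy / stabilisation in the tree;
definition request D1 in `StubSortedModelGlueMemo.md`). -/

/-! ## Bookkeeping of sorted words -/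

section SortedWords

variable {V : Type*}

/-- In a word all of whose letters are positive, the positive classes are all the classes. [folklore] -/
theorem classesOfSign_true_eq_letters_of_forall {P : List (V × Bool)} (hP : ∀ x ∈ P, x.2 = true) :
    classesOfSign P true = letters P := by
  ext v
  simp only [classesOfSign, letters, Set.mem_setOf_eq]
  constructor
  · intro h; exact ⟨true, h⟩
  · rintro ⟨s, hs⟩
    have := hP _ hs
    simp only at this
    subst this
    exact hs

/-- In a word all of whose letters are negative there are no positive classes. [folklore] -/
theorem classesOfSign_true_eq_empty_of_forall {N : List (V × Bool)} (hN : ∀ x ∈ N, x.2 = false) :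
    classesOfSign N true = ∅ := by
  ext v
  simp only [classesOfSign, Set.mem_setOf_eq, Set.mem_empty_iff_false, iff_false]
  intro h
  have := hN _ h
  simp at this

/-- The positive classes of a concatenation. [folklore] -/
theorem classesOfSign_append (P N : List (V × Bool)) (s : Bool) :
    classesOfSign (P ++ N) s = classesOfSign P s ∪ classesOfSign N s := by
  ext v
  simp [classesOfSign, List.mem_append]

/-- The positive classes of a sorted word `P ++ N` are the classes of `P`. [folklore] -/
theorem classesOfSign_true_sorted {P N : List (V × Bool)} (hP : ∀ x ∈ P, x.2 = true)
    (hN : ∀ x ∈ N, x.2 = false) : classesOfSign (P ++ N) true = letters P := by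
  rw [classesOfSign_append, classesOfSign_true_eq_letters_of_forall hP,
    classesOfSign_true_eq_empty_of_forall hN, Set.union_empty]

/-- The positive letters of a sorted word `P ++ N` are `P`. [folklore] -/
theorem filter_snd_sorted {P N : List (V × Bool)} (hP : ∀ x ∈ P, x.2 = true)
    (hN : ∀ x ∈ N, x.2 = false) : (P ++ N).filter (·.2) = P := by
  rw [List.filter_append, List.filter_eq_self.2 (by simpa using hP),
    List.filter_eq_nil_iff.2 (by simpa using hN), List.append_nil]

/-- Signs are unchanged by a change of coefficients. [folklore] -/
theorem forall_snd_mapWord {W : Type*} (φ : V → W) {L : List (V × Bool)} {b : Bool}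
    (hL : ∀ x ∈ L, x.2 = b) : ∀ x ∈ mapWord φ L, x.2 = b := by
  intro x hx
  obtain ⟨y, hy, rfl⟩ := List.mem_map.1 hx
  exact hL y hy

end SortedWords

/-! ## The dictionary stub from the six named facts -/

/-- Local notation: the round 4-sphere. -/
local notation "𝕊⁴" => (Metric.sphere (0 : EuclideanSpace ℝ (Fin 5)) 1)

/-- **The sorted-model dictionary of a nice splitting of a homotopy 4-sphere, from the six named facts
of the Lefschetz-handlebody dictionary** (Etnyre–Fuller 2006 Thm. 1/Prop. 12/eq. (d3); Baykur 2006
Lemma 1, §5, Thm. 5.1; Gompf–Stipsicz 1999 §8.2; Akbulut–Ozbagci 2001 Thm. 5).  The conclusion is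
verbatim the registered signature of `stub_sortedModelOfHandleSplitting` (line `modp-braid-orbits`, r8);
the nice-splitting hypotheses are not used (the fibred model of fact 1 is taken on `M` directly, which is
compact, connected and orientable by the proved homotopy-sphere facts of the tree).
[cite: EtnyreFuller2006, Thm. 1, Prop. 12, eq. (d3)] [cite: Baykur2006, Lemma 1 and Thm. 5.1]
[cite: GompfStipsicz1999, §8.2] -/
theorem stub_sortedModelOfHandleSplitting_of
    (h₁ : ∀ (M : Type) [TopologicalSpace M] [T2Space M] [SecondCountableTopology M] [CompactSpace M]
      [ConnectedSpace M] [ChartedSpace (EuclideanSpace ℝ (Fin 4)) M] [IsManifold (𝓡 4) ∞ M],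
      IsOrientable (𝓡 4) M →
      ∃ (g : ℕ) (l : List ((Fin g ⊕ Fin g → ℤ) × Bool)), (∀ x ∈ l, x.1 ≠ 0) ∧ ModelsOnFibred M g l)
    (h₂ : ∀ (M : Type) [TopologicalSpace M] [T2Space M] [SecondCountableTopology M]
      [ChartedSpace (EuclideanSpace ℝ (Fin 4)) M] [IsManifold (𝓡 4) ∞ M] (g : ℕ)
      (l : List ((Fin g ⊕ Fin g → ℤ) × Bool)),
      M ≃ₕ Metric.sphere (0 : EuclideanSpace ℝ (Fin 5)) 1 → ModelsOn M g l →
      l.length = 4 * g ∧ Submodule.span ℚ (letters (ratWord l)) = ⊤)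
    (h₃ : ∀ (M : Type) [TopologicalSpace M] [T2Space M] [SecondCountableTopology M]
      [ChartedSpace (EuclideanSpace ℝ (Fin 4)) M] [IsManifold (𝓡 4) ∞ M] (g : ℕ)
      (l : List ((Fin g ⊕ Fin g → ℤ) × Bool)),
      M ≃ₕ Metric.sphere (0 : EuclideanSpace ℝ (Fin 5)) 1 → ModelsOnFibred M g l →
      (l.filter (·.2)).length = 2 * g)
    (h₄ : ∀ (M : Type) [TopologicalSpace M] [T2Space M] [SecondCountableTopology M]
      [ChartedSpace (EuclideanSpace ℝ (Fin 4)) M] [IsManifold (𝓡 4) ∞ M] (g : ℕ) (l : IntWord g)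
      (g' : ℕ) (l' : IntWord g'),
      ModelsOnFibred M g l → Reach g l g' l' → ModelsOnFibred M g' l')
    (h₅ : ∀ (g : ℕ) (l : List ((Fin g ⊕ Fin g → ℤ) × Bool)) (X : Type) [TopologicalSpace X] [T2Space X]
      [SecondCountableTopology X] [CompactSpace X] [ChartedSpace (EuclideanHalfSpace 4) X]
      [IsManifold (𝓡∂ 4) ∞ X],
      IsLefschetzHandlebody g l X →
      ConnectedSpace X ∧
        Nonempty ((singularHomology ℤ ℤ X 1) ≃ₗ[ℤ]
          ((Fin g ⊕ Fin g → ℤ) ⧸ Submodule.span ℤ (letters l))) ∧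
        (Submodule.span ℚ (letters (ratWord l)) = ⊤ → l.length = 2 * g →
          ∀ k, 0 < k → CategoryTheory.Limits.IsZero (singularHomology ℚ ℚ X k)))
    (h₆ : ∀ (M : Type) [TopologicalSpace M] [T2Space M] [SecondCountableTopology M]
      [ChartedSpace (EuclideanSpace ℝ (Fin 4)) M] [IsManifold (𝓡 4) ∞ M] (g : ℕ)
      (P N : List ((Fin g ⊕ Fin g → ℤ) × Bool)),
      ModelsOnFibred M g (P ++ N) → (∀ x ∈ P, x.2 = true) → (∀ x ∈ N, x.2 = false) →
      (∀ x ∈ P ++ N, x.1 ≠ 0) →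
      ∃ (W₁ : Type) (_ : TopologicalSpace W₁) (_ : ChartedSpace (EuclideanHalfSpace 4) W₁)
        (_ : IsManifold (𝓡∂ 4) ∞ W₁) (_ : CompactSpace W₁) (_ : T2Space W₁)
        (_ : SecondCountableTopology W₁)
        (W₂ : Type) (_ : TopologicalSpace W₂) (_ : ChartedSpace (EuclideanHalfSpace 4) W₂)
        (_ : IsManifold (𝓡∂ 4) ∞ W₂) (_ : CompactSpace W₂)
        (S₁ : SteinStructure W₁) (S₂ : SteinStructure W₂)
        (b₁ : BoundaryData (𝓡∂ 4) W₁ (𝓡 3)) (b₂ : BoundaryData (𝓡∂ 4) W₂ (𝓡 3))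
        (φ : b₁.carrier ≃ₘ⟮𝓡 3, 𝓡 3⟯ b₂.carrier)
        (ob : OpenBook b₁.carrier)
        (α₁ α₂ : Literature.Geometry.Kaehler.MForm (𝓡 3) b₁.carrier ℝ 1),
        IsBoundaryGluing b₁ b₂ φ (𝓡 4) M ∧
        ob.IsGirouxForm (boundaryPlaneField S₁.J b₁) α₁ ∧
        ob.IsGirouxForm (fun y => (boundaryPlaneField S₂.J b₂ (φ y)).comap
          (mfderiv (𝓡 3) (𝓡 3) φ y).toLinearMap) α₂ ∧
        (∀ y u v w, 0 < wedge₁₂ (α₁ y) (Literature.Geometry.Kaehler.mextDeriv α₁ y) u v w ↔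
          0 < wedge₁₂ (α₂ y) (Literature.Geometry.Kaehler.mextDeriv α₂ y) u v w) ∧
        IsLefschetzHandlebody g P W₁) :
    ∀ (M : Type) [TopologicalSpace M] [T2Space M] [SecondCountableTopology M]
      [ChartedSpace (EuclideanSpace ℝ (Fin 4)) M] [IsManifold (𝓡 4) ∞ M],
      M ≃ₕ Metric.sphere (0 : EuclideanSpace ℝ (Fin 5)) 1 →
      ∀ (A : Type) [TopologicalSpace A] [T2Space A] [SecondCountableTopology A] [CompactSpace A]
        [ChartedSpace (EuclideanHalfSpace 4) A] [IsManifold (𝓡∂ 4) ∞ A]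
        (B : Type) [TopologicalSpace B] [T2Space B] [SecondCountableTopology B] [CompactSpace B]
        [ChartedSpace (EuclideanHalfSpace 4) B] [IsManifold (𝓡∂ 4) ∞ B]
        (bA : BoundaryData (𝓡∂ 4) A (𝓡 3)) (bB : BoundaryData (𝓡∂ 4) B (𝓡 3))
        (φ₀ : bA.carrier ≃ₘ⟮𝓡 3, 𝓡 3⟯ bB.carrier),
        IsHandlebodyOfIndexLE 3 2 A → IsHandlebodyOfIndexLE 3 1 B → IsBoundaryGluing bA bB φ₀ (𝓡 4) M →
        Nonempty bA.carrier → ConnectedSpace A → ConnectedSpace B → ConnectedSpace bA.carrier →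
        CategoryTheory.Limits.IsZero (singularHomology ℚ ℚ A 1) →
      ∃ (g : ℕ) (l : IntWord g),
        l.length = 4 * g ∧ (l.filter (·.2)).length = 2 * g ∧
        (∀ x ∈ l, x.1 ≠ 0) ∧
        Submodule.span ℚ (letters (ratWord l)) = ⊤ ∧
        ∀ (g' : ℕ) (l' : IntWord g'),
          Reach g l g' l' → Sorted l' →
          Submodule.span ℚ (classesOfSign (ratWord l') true) = ⊤ →
          ∃ (W₁ : Type) (_ : TopologicalSpace W₁) (_ : ChartedSpace (EuclideanHalfSpace 4) W₁)
            (_ : IsManifold (𝓡∂ 4) ∞ W₁) (_ : CompactSpace W₁)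
            (W₂ : Type) (_ : TopologicalSpace W₂) (_ : ChartedSpace (EuclideanHalfSpace 4) W₂)
            (_ : IsManifold (𝓡∂ 4) ∞ W₂) (_ : CompactSpace W₂)
            (S₁ : SteinStructure W₁) (S₂ : SteinStructure W₂)
            (b₁ : BoundaryData (𝓡∂ 4) W₁ (𝓡 3)) (b₂ : BoundaryData (𝓡∂ 4) W₂ (𝓡 3))
            (φ : b₁.carrier ≃ₘ⟮𝓡 3, 𝓡 3⟯ b₂.carrier)
            (ob : OpenBook b₁.carrier)
            (α₁ α₂ : Literature.Geometry.Kaehler.MForm (𝓡 3) b₁.carrier ℝ 1),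
            IsBoundaryGluing b₁ b₂ φ (𝓡 4) M ∧
            ob.IsGirouxForm (boundaryPlaneField S₁.J b₁) α₁ ∧
            ob.IsGirouxForm (fun y => (boundaryPlaneField S₂.J b₂ (φ y)).comap
              (mfderiv (𝓡 3) (𝓡 3) φ y).toLinearMap) α₂ ∧
            (∀ y u v w, 0 < wedge₁₂ (α₁ y) (Literature.Geometry.Kaehler.mextDeriv α₁ y) u v w ↔
              0 < wedge₁₂ (α₂ y) (Literature.Geometry.Kaehler.mextDeriv α₂ y) u v w) ∧
            ConnectedSpace W₁ ∧
            (∀ k, 0 < k → CategoryTheory.Limits.IsZero (singularHomology ℚ ℚ W₁ k)) ∧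
            Nonempty ((singularHomology ℤ ℤ W₁ 1) ≃ₗ[ℤ]
              ((Fin g' ⊕ Fin g' → ℤ) ⧸ Submodule.span ℤ (classesOfSign l' true))) := by
  intro M _ _ _ _ _ e A _ _ _ _ _ _ B _ _ _ _ _ _ bA bB φ₀ _ _ _ _ _ _ _ _
  -- `M` is compact, connected, orientable (proved homotopy-sphere facts of the tree)
  haveI : CompactSpace M := compactSpace_of_homotopyEquiv_sphere_four_holds M e
  haveI : SimplyConnectedSpace 𝕊⁴ := simplyConnectedSpace_sphere_four_holds
  haveI : SimplyConnectedSpace M := e.simplyConnectedSpace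
  haveI : ConnectedSpace M := inferInstance
  have hor : IsOrientable (𝓡 4) M := isOrientable_of_homotopyEquiv_sphere_four_holds M e
  -- fact 1: an allowable fibred model
  obtain ⟨g, l, hnz, hfib⟩ := h₁ M hor
  -- facts 2′, 3: the counts of a homotopy 4-sphere
  obtain ⟨hlen, hspan⟩ := h₂ M g l e hfib.modelsOn
  have hbal : (l.filter (·.2)).length = 2 * g := h₃ M g l e hfib
  refine ⟨g, l, hlen, hbal, hnz, hspan, ?_⟩
  -- the realisation clause
  intro g' l' hreach hsorted hpos
  -- fact 4: the reachable word is again a fibred model; proved bookkeeping along `Reach`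
  have hfib' : ModelsOnFibred M g' l' := h₄ M g l g' l' hfib hreach
  have hnz' : ∀ x ∈ l', x.1 ≠ 0 := reach_forall_ne_zero' hreach hnz
  have hbal' : (l'.filter (·.2)).length = 2 * g' := reach_length_filter_eq_two_mul' hreach hbal
  obtain ⟨P, N, rfl, hP, hN⟩ := hsorted
  -- fact 6: Baykur's Stein realisation of the sorted fibred model
  obtain ⟨W₁, _, _, _, _, _, _, W₂, _, _, _, _, S₁, S₂, b₁, b₂, φ, ob, α₁, α₂, hglue, hG₁, hG₂,
    hor', hLH⟩ := h₆ M g' P N hfib' hP hN hnz'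
  -- fact 5: homology of the Lefschetz handlebody `W₁ = X(F; P)`
  obtain ⟨hconn, ⟨iso⟩, hacyc⟩ := h₅ g' P W₁ hLH
  -- bookkeeping: positive classes of `P ++ N` are the classes of `P`; `P` has `2g'` letters
  have hcl : classesOfSign (P ++ N) true = letters P := classesOfSign_true_sorted hP hN
  have hclQ : classesOfSign (ratWord (P ++ N)) true = letters (ratWord P) := by
    rw [ratWord, mapWord_append]
    exact classesOfSign_true_sorted (forall_snd_mapWord _ hP) (forall_snd_mapWord _ hN)
  have hlenP : P.length = 2 * g' := by rw [← hbal', filter_snd_sorted hP hN]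
  have hspanP : Submodule.span ℚ (letters (ratWord P)) = ⊤ := by rw [← hclQ]; exact hpos
  refine ⟨W₁, inferInstance, inferInstance, inferInstance, inferInstance, W₂, inferInstance,
    inferInstance, inferInstance, inferInstance, S₁, S₂, b₁, b₂, φ, ob, α₁, α₂, hglue, hG₁, hG₂, hor',
    hconn, hacyc hspanP hlenP, ?_⟩
  rw [hcl]
  exact ⟨iso⟩

/-- **Stub 1 (r11 form: r8 signature minus the idle monodromy clause and negative-span hypothesis), PROVED
from the four fact stubs, NF2′ and NF5** (composition `stub_sortedModelOfHandleSplitting_of` above; the r9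
form with all six hypotheses NAMED is landed as `Theorems/ConvexBisectionAcyclicBisectionExistsStubSortedModelOf.lean`,
p120221). -/
theorem stub_sortedModelOfHandleSplitting :
    ∀ (M : Type) [TopologicalSpace M] [T2Space M] [SecondCountableTopology M]
      [ChartedSpace (EuclideanSpace ℝ (Fin 4)) M] [IsManifold (𝓡 4) ∞ M],
      M ≃ₕ Metric.sphere (0 : EuclideanSpace ℝ (Fin 5)) 1 →
      ∀ (A : Type) [TopologicalSpace A] [T2Space A] [SecondCountableTopology A] [CompactSpace A]
        [ChartedSpace (EuclideanHalfSpace 4) A] [IsManifold (𝓡∂ 4) ∞ A]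
        (B : Type) [TopologicalSpace B] [T2Space B] [SecondCountableTopology B] [CompactSpace B]
        [ChartedSpace (EuclideanHalfSpace 4) B] [IsManifold (𝓡∂ 4) ∞ B]
        (bA : BoundaryData (𝓡∂ 4) A (𝓡 3)) (bB : BoundaryData (𝓡∂ 4) B (𝓡 3))
        (φ₀ : bA.carrier ≃ₘ⟮𝓡 3, 𝓡 3⟯ bB.carrier),
        IsHandlebodyOfIndexLE 3 2 A → IsHandlebodyOfIndexLE 3 1 B → IsBoundaryGluing bA bB φ₀ (𝓡 4) M →
        Nonempty bA.carrier → ConnectedSpace A → ConnectedSpace B → ConnectedSpace bA.carrier →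
        CategoryTheory.Limits.IsZero (singularHomology ℚ ℚ A 1) →
      ∃ (g : ℕ) (l : IntWord g),
        l.length = 4 * g ∧ (l.filter (·.2)).length = 2 * g ∧
        (∀ x ∈ l, x.1 ≠ 0) ∧
        Submodule.span ℚ (letters (ratWord l)) = ⊤ ∧
        ∀ (g' : ℕ) (l' : IntWord g'),
          Reach g l g' l' → Sorted l' →
          Submodule.span ℚ (classesOfSign (ratWord l') true) = ⊤ →
          ∃ (W₁ : Type) (_ : TopologicalSpace W₁) (_ : ChartedSpace (EuclideanHalfSpace 4) W₁)
            (_ : IsManifold (𝓡∂ 4) ∞ W₁) (_ : CompactSpace W₁)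
            (W₂ : Type) (_ : TopologicalSpace W₂) (_ : ChartedSpace (EuclideanHalfSpace 4) W₂)
            (_ : IsManifold (𝓡∂ 4) ∞ W₂) (_ : CompactSpace W₂)
            (S₁ : SteinStructure W₁) (S₂ : SteinStructure W₂)
            (b₁ : BoundaryData (𝓡∂ 4) W₁ (𝓡 3)) (b₂ : BoundaryData (𝓡∂ 4) W₂ (𝓡 3))
            (φ : b₁.carrier ≃ₘ⟮𝓡 3, 𝓡 3⟯ b₂.carrier)
            (ob : OpenBook b₁.carrier)
            (α₁ α₂ : Literature.Geometry.Kaehler.MForm (𝓡 3) b₁.carrier ℝ 1),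
            IsBoundaryGluing b₁ b₂ φ (𝓡 4) M ∧
            ob.IsGirouxForm (boundaryPlaneField S₁.J b₁) α₁ ∧
            ob.IsGirouxForm (fun y => (boundaryPlaneField S₂.J b₂ (φ y)).comap
              (mfderiv (𝓡 3) (𝓡 3) φ y).toLinearMap) α₂ ∧
            (∀ y u v w, 0 < wedge₁₂ (α₁ y) (Literature.Geometry.Kaehler.mextDeriv α₁ y) u v w ↔
              0 < wedge₁₂ (α₂ y) (Literature.Geometry.Kaehler.mextDeriv α₂ y) u v w) ∧
            ConnectedSpace W₁ ∧
            (∀ k, 0 < k → CategoryTheory.Limits.IsZero (singularHomology ℚ ℚ W₁ k)) ∧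
            Nonempty ((singularHomology ℤ ℤ W₁ 1) ≃ₗ[ℤ]
              ((Fin g' ⊕ Fin g' → ℤ) ⧸ Submodule.span ℤ (classesOfSign l' true))) :=
  stub_sortedModelOfHandleSplitting_of stub_modelsOnFibred_exists modelsOn_counts_lengthSpan
    stub_modelsOnFibred_balance stub_modelsOnFibred_of_reach stub_isLefschetzHandlebody_homology
    stub_steinRealisation

/-! ## Step GG — Giroux uniqueness + Gray stability (r5; r6 split; r7: the two named facts are PROVED)

Two plane fields on a closed 3-manifold that are kernels of Giroux forms for the SAME open book
(`OpenBook.IsGirouxForm`), the two forms inducing the same orientation, differ by a diffeomorphism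
isotopic to the identity: Giroux 2002 (a path of contact forms: Etnyre 2006 Prop. 3.18) followed by Gray's
stability theorem (Gray 1959; Geiges 2008 Thm 2.2.2).  Both inputs are THEOREMS of the tree
(`Literature.Geometry.Symplectic.GirouxContactPath_holds`, `Literature.Geometry.Symplectic.GrayStability_holds`,
`GirouxContactPathProofs.lean`), and the reduction `stub_girouxGray_of` is LANDED (p87434); r6's stubs
`stub_girouxContactPath` / `stub_grayStability` are discharged by
`Literature.Geometry.Symplectic.GirouxContactPath_holds` / `Literature.Geometry.Symplectic.GrayStability_holds`
(used directly in the composition). -/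
example : Literature.Geometry.Symplectic.GirouxContactPath :=
  Literature.Geometry.Symplectic.GirouxContactPath_holds

example : Literature.Geometry.Symplectic.GrayStability :=
  Literature.Geometry.Symplectic.GrayStability_holds

/-- **Giroux–Gray from the two named facts** (the r5 stub `stub_girouxGray`, made conditional on
`GirouxContactPath` and `GrayStability`) — LANDED p87434 as
`Theorems/ConvexBisectionAcyclicBisectionExistsStubGirouxGray.lean` (helpers `isIsotopic_toDiffeomorph_one_refl`,
`submodule_map_mfderiv_eq_of_iff`). -/
theorem stub_girouxGray_of :
    Literature.Geometry.Symplectic.GirouxContactPath → Literature.Geometry.Symplectic.GrayStability →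
    ∀ (N : Type) [TopologicalSpace N] [T2Space N] [CompactSpace N]
      [ChartedSpace (EuclideanSpace ℝ (Fin 3)) N] [IsManifold (𝓡 3) ∞ N]
      (ob : OpenBook N) (ξ ξ' : N → Submodule ℝ (EuclideanSpace ℝ (Fin 3)))
      (α α' : Literature.Geometry.Kaehler.MForm (𝓡 3) N ℝ 1),
      ob.IsGirouxForm ξ α → ob.IsGirouxForm ξ' α' →
      (∀ y u v w, 0 < wedge₁₂ (α y) (Literature.Geometry.Kaehler.mextDeriv α y) u v w ↔
        0 < wedge₁₂ (α' y) (Literature.Geometry.Kaehler.mextDeriv α' y) u v w) →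
      ∃ φ₀ : N ≃ₘ⟮𝓡 3, 𝓡 3⟯ N,
        Literature.Topology.FourManifolds.Diffeomorph.IsIsotopic φ₀ (Diffeomorph.refl (𝓡 3) N ∞) ∧
        ∀ y, (ξ y).map (mfderiv (𝓡 3) (𝓡 3) φ₀ y).toLinearMap = ξ' (φ₀ y) :=
  -- LANDED (p87434): Theorems/ConvexBisectionAcyclicBisectionExistsStubGirouxGray.lean
  Summit.SmoothPoincare4.SmoothPoincare4.Theorems.AcyclicBisectionExists.ModpBraidOrbits.stub_girouxGray_of

/-! ## Stub IR — re-gluing along an isotopic identification (NEW in r5; Hirsch 8.2.3) — LANDED p81429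

If `M = W₁ ∪_φ W₂` and `φ₀ ∈ Diff ∂W₁` is isotopic to the identity, then also `M = W₁ ∪_{φ₀ ≫ φ} W₂`:
post-compose the isotopy with `φ` and apply the tree's PROVED
`Literature.Topology.FourManifolds.IsBoundaryGluing.of_isSmoothlyIsotopic` (`GluingIsotopyProofs.lean`).
Size S. -/
theorem stub_isotopyRegluing :
    ∀ (M : Type) [TopologicalSpace M] [T2Space M] [SecondCountableTopology M]
      [ChartedSpace (EuclideanSpace ℝ (Fin 4)) M] [IsManifold (𝓡 4) ∞ M]
      (W₁ : Type) [TopologicalSpace W₁] [ChartedSpace (EuclideanHalfSpace 4) W₁]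
        [IsManifold (𝓡∂ 4) ∞ W₁] [CompactSpace W₁]
      (W₂ : Type) [TopologicalSpace W₂] [ChartedSpace (EuclideanHalfSpace 4) W₂]
        [IsManifold (𝓡∂ 4) ∞ W₂] [CompactSpace W₂]
      (b₁ : BoundaryData (𝓡∂ 4) W₁ (𝓡 3)) (b₂ : BoundaryData (𝓡∂ 4) W₂ (𝓡 3))
      (φ : b₁.carrier ≃ₘ⟮𝓡 3, 𝓡 3⟯ b₂.carrier) (φ₀ : b₁.carrier ≃ₘ⟮𝓡 3, 𝓡 3⟯ b₁.carrier),
      IsBoundaryGluing b₁ b₂ φ (𝓡 4) M →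
      Literature.Topology.FourManifolds.Diffeomorph.IsIsotopic φ₀ (Diffeomorph.refl (𝓡 3) b₁.carrier ∞) →
      IsBoundaryGluing b₁ b₂ (φ₀.trans φ) (𝓡 4) M :=
  -- LANDED (p81429): Theorems/ConvexBisectionAcyclicBisectionExistsStubIsotopyRegluing.lean
  Summit.SmoothPoincare4.SmoothPoincare4.Theorems.AcyclicBisectionExists.ModpBraidOrbits.stub_isotopyRegluing

/-! ## Stub CP — the re-glued identification is a contactomorphism of plane fields (NEW in r5; chain rule) — LANDED p82564

If `dφ₀` carries `ξ₁' = boundaryPlaneField S₁.J b₁` onto the pull-back `φ^* ξ₂'` of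
`ξ₂' = boundaryPlaneField S₂.J b₂`, then `d(ι₂ ∘ φ ∘ φ₀)` carries `ξ₁'` onto the complex tangencies
`contactPlane S₂.J` pointwise — `dφ` is an isomorphism (so `map ∘ comap = id` along it) and `dι₂` maps the
pulled-back plane field onto `contactPlane S₂.J` (landed `Negative.map_mfderiv_incl_boundaryPlaneField`).
Size S–M. -/
theorem stub_contactoPlanes :
    ∀ (W₁ : Type) [TopologicalSpace W₁] [ChartedSpace (EuclideanHalfSpace 4) W₁]
        [IsManifold (𝓡∂ 4) ∞ W₁] [CompactSpace W₁]
      (W₂ : Type) [TopologicalSpace W₂] [ChartedSpace (EuclideanHalfSpace 4) W₂]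
        [IsManifold (𝓡∂ 4) ∞ W₂] [CompactSpace W₂]
      (S₁ : SteinStructure W₁) (S₂ : SteinStructure W₂)
      (b₁ : BoundaryData (𝓡∂ 4) W₁ (𝓡 3)) (b₂ : BoundaryData (𝓡∂ 4) W₂ (𝓡 3))
      (φ : b₁.carrier ≃ₘ⟮𝓡 3, 𝓡 3⟯ b₂.carrier) (φ₀ : b₁.carrier ≃ₘ⟮𝓡 3, 𝓡 3⟯ b₁.carrier),
      (∀ y, (boundaryPlaneField S₁.J b₁ y).map (mfderiv (𝓡 3) (𝓡 3) φ₀ y).toLinearMap =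
        (boundaryPlaneField S₂.J b₂ (φ (φ₀ y))).comap (mfderiv (𝓡 3) (𝓡 3) φ (φ₀ y)).toLinearMap) →
      ∀ z, Submodule.map (mfderiv (𝓡 3) (𝓡∂ 4) (b₂.incl ∘ (φ₀.trans φ)) z).toLinearMap
          (boundaryPlaneField S₁.J b₁ z) = contactPlane S₂.J (b₂.incl ((φ₀.trans φ) z)) :=
  -- LANDED (p82564): Theorems/ConvexBisectionAcyclicBisectionExistsStubContactoPlanes.lean
  Summit.SmoothPoincare4.SmoothPoincare4.Theorems.AcyclicBisectionExists.ModpBraidOrbits.stub_contactoPlanes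

/-! ## Stub G — twisted-glue data give the crux's ∃-body (NEW in r4) — LANDED p78503

Over `M ≃ₕ S⁴`: if `M = W₁ ∪_ψ W₂` is the boundary gluing of two compact Stein domains along a
diffeomorphism `ψ : ∂W₁ ≅ ∂W₂` carrying the `S₁`-induced boundary plane field onto the complex tangencies
of `S₂`, and `W₁` is connected and ℚ-acyclic in positive degrees, then `M` carries a witness of the crux
with both halves ℚ-acyclic (`HasAcyclicSteinBisection M`).  Proof: the landed
`Negative.Witness.ofTwistedGlue b₁ b₂ S₁ S₂ ψ hψ hglue : Witness M` (its `W₁` is `W₁`) has the six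
point-set/contact properties; its right half is ℚ-acyclic by the landed one-sided duality
`Negative.Witness.acyclicRight_of_acyclicLeft_of_homotopyEquiv'` (needs only `ConnectedSpace W₁`).
Size S.  LANDED as `Theorems/ConvexBisectionAcyclicBisectionExistsStubGlueWitness.lean` (p78503). -/
theorem stub_glueWitness :
    ∀ (M : Type) [TopologicalSpace M] [T2Space M] [SecondCountableTopology M]
      [ChartedSpace (EuclideanSpace ℝ (Fin 4)) M] [IsManifold (𝓡 4) ∞ M],
      M ≃ₕ Metric.sphere (0 : EuclideanSpace ℝ (Fin 5)) 1 →
      ∀ (W₁ : Type) [TopologicalSpace W₁] [ChartedSpace (EuclideanHalfSpace 4) W₁]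
        [IsManifold (𝓡∂ 4) ∞ W₁] [CompactSpace W₁]
        (W₂ : Type) [TopologicalSpace W₂] [ChartedSpace (EuclideanHalfSpace 4) W₂]
        [IsManifold (𝓡∂ 4) ∞ W₂] [CompactSpace W₂]
        (S₁ : SteinStructure W₁) (S₂ : SteinStructure W₂)
        (b₁ : BoundaryData (𝓡∂ 4) W₁ (𝓡 3)) (b₂ : BoundaryData (𝓡∂ 4) W₂ (𝓡 3))
        (ψ : b₁.carrier ≃ₘ⟮𝓡 3, 𝓡 3⟯ b₂.carrier),
        (∀ z, Submodule.map (mfderiv (𝓡 3) (𝓡∂ 4) (b₂.incl ∘ ψ) z).toLinearMap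
            (boundaryPlaneField S₁.J b₁ z) = contactPlane S₂.J (b₂.incl (ψ z))) →
        IsBoundaryGluing b₁ b₂ ψ (𝓡 4) M →
        ConnectedSpace W₁ →
        (∀ k, 0 < k → CategoryTheory.Limits.IsZero (singularHomology ℚ ℚ W₁ k)) →
        HasAcyclicSteinBisection M :=
  -- LANDED (p78503): Theorems/ConvexBisectionAcyclicBisectionExistsStubGlueWitness.lean
  Summit.SmoothPoincare4.SmoothPoincare4.Theorems.AcyclicBisectionExists.ModpBraidOrbits.stub_glueWitness

/-! ## Stub 2 — one-sided acyclicity suffices (LANDED p72264; off the r4 composition path)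

`Summit.SmoothPoincare4.SmoothPoincare4.Theorems.AcyclicBisectionExists.ModpBraidOrbits.stub_acyclicRight`
(`Theorems/ConvexBisectionAcyclicBisectionExistsStubAcyclicRight.lean`, a repackaging of the disprover's
`Negative.Witness.acyclicRight_of_acyclicLeft_of_homotopyEquiv'`) stays a support of the item; in r4 the same
duality is consumed inside `stub_glueWitness`, so the declaration is no longer restated here. -/

/-! ## Stub E — the EXCHANGE LEMMA (E1 engine; NEW in r3; replaces `stub_modpOrbit` + `stub_reductionLift`
on the composition path) — LANDED p76279 (with Literature/…/SignedHurwitzTravel.lean p75520, …/SignedHurwitzExchange.lean p75661)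

For an integral signed word `l` at genus `g` with `4g` letters, `2g` of them positive, all classes
non-zero and all classes together spanning `ℚ^{2g}`: some `(g', l')` reachable by signed Hurwitz moves and
stabilisation-pair moves has `4g'` letters, `2g'` positive, and POSITIVE classes spanning `ℚ^{2g'}`.
Proof (hurwitz-tilt-exchange (5), one-word form; induction on the corank `r` of `U := span ℚ (positive
classes)`): if `r > 0` pick a NEGATIVE letter `w ∉ U` (all letters span) and a REDUNDANT positive letter
`y` (`2g` positive letters inside `U`, `dim U < 2g`); move `w` next to `y` on its left by Hurwitz moves
that keep every positive class (passing a positive `q`: the option that keeps `q` and replaces `w` by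
`w ± ω(q,w) q ∈ w + U`; passing a negative: the option that keeps `w`; the final pass over `y` itself if
`w` started on the right); cut between `w` and `y` and apply `StabStep` with a primitive `c` such that
`ω(c, w) ≠ 0 ≠ ω(c, y)` (a standard basis vector or a sum of two); tilt `u₁ = e + c` by `w`
(`u₁ ↦ u₁ − ω(w,c)·w`, positive) and `y` by `u₁⁻` (`y ↦ y − ω(c,y)·u₁`, positive): modulo
`Ū = embed U` the three new positive classes are `e + c̄ + λ w̄`, `f`, `μ (e + c̄)` with `λ μ ≠ 0`,
`w̄ ≠ 0`, hence independent — `dim` of the positive span grows by `3` while the ambient dimension grows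
by `2`: corank `r − 1`.  Invariants (`4g'` letters, `2g'` positive, non-zero classes, all classes span)
persist.  Size M–L (≈ 400 lines; Mathlib + the two vocabulary files). -/
theorem stub_exchange :
    ∀ (g : ℕ) (l : IntWord g),
      l.length = 4 * g → (l.filter (·.2)).length = 2 * g →
      (∀ x ∈ l, x.1 ≠ 0) →
      Submodule.span ℚ (letters (ratWord l)) = ⊤ →
      ∃ (g' : ℕ) (l' : IntWord g'),
        Reach g l g' l' ∧ l'.length = 4 * g' ∧ (l'.filter (·.2)).length = 2 * g' ∧
        Submodule.span ℚ (classesOfSign (ratWord l') true) = ⊤ :=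
  -- LANDED (p76279): Theorems/ConvexBisectionAcyclicBisectionExistsStubExchange.lean
  Summit.SmoothPoincare4.SmoothPoincare4.Theorems.AcyclicBisectionExists.ModpBraidOrbits.stub_exchange

/-! ## Off the r11 composition path (landed supports of the item, recorded for the history)

`stub_reachInvariants` (p74995, `Theorems/ConvexBisectionAcyclicBisectionExistsStubReachInvariants.lean`: `Reach`
preserves `wordProduct = 1`) and `stub_sortBiSpan` (p72877, `…StubSortBiSpan.lean`: sorting + the second,
NEGATIVE basis from `wordProduct = 1`) served the r3–r10 compositions; r11 sorts with the product-free half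
`SortBiSpan.exists_sorted` of the latter file and needs neither. -/

/-! ## Composition lemmas (sorry-free): passing from `ℤ` to `ℚ` -/

section RatLemmas

variable {g : ℕ}

/-- `ratWord` is the coordinatewise change of coefficients along `Int.castRingHom ℚ`. -/
theorem ratWord_eq_mapWord (l : IntWord g) :
    ratWord l = mapWord (fun (v : Fin g ⊕ Fin g → ℤ) i => Int.castRingHom ℚ (v i)) l := rfl

end RatLemmas

/-! ## Composition — the crux from the stubs (no `sorry` outside the registered stubs) -/

/-- **`AcyclicBisectionExists` from the line (r11).** Nice splitting (tree) → bookkeeping (Stub 0b, landed) →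
dictionary (Stub 1, proved from NF1, NF2′, NF3, NF4, NF5, NF6) → exchange engine (Stub E, landed) → sorting
over `ℚ` inside the Hurwitz orbit keeping the positive letters (`SortBiSpan.exists_sorted`, landed) → lift to
the integral orbit (`hurwitzOrbit_lift`, landed) → realisation clause: Baykur's split `M = W₁ ∪_φ W₂` with one
open book supporting both boundary plane fields, `W₁` connected and ℚ-acyclic → Giroux–Gray (landed reduction
applied to the tree's two theorems) → re-gluing along the isotopic identification (Stub IR, landed) → pointwise
plane matching (Stub CP, landed) → a witness of the crux, `W₂` ℚ-acyclic by one-sided duality (Stub G, landed). -/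
theorem AcyclicBisectionExists_of :
    _root_.Summit.SmoothPoincare4.SmoothPoincare4.Theses.ConvexBisection.AcyclicBisectionExists := by
  intro M _ _ _ _ _ e
  -- Step 0 (tree): the nice splitting `M = A ∪_{φA} B`
  obtain ⟨A, B, _, _, _, _, _, _, _, _, _, _, _, _, bA, bB, φA, hA, hB, hsplit⟩ := exists_niceSplitting M e
  -- Stub 0b: bookkeeping of the splitting (seam nonempty; `A`, `B`, `∂A` connected; `H₁(A; ℚ) = 0`)
  obtain ⟨hne, hcA, hcB, hcS, hH1⟩ := stub_niceSplittingBookkeeping M e A B bA bB φA hA hB hsplit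
  -- Stub 1: the integral model of the splitting
  obtain ⟨g, l, hlen, hbal, hnz, hspanQ, hreal⟩ :=
    stub_sortedModelOfHandleSplitting M e A B bA bB φA hA hB hsplit hne hcA hcB hcS hH1
  -- Stub E: the exchange engine
  obtain ⟨g', l', hreach, -, -, hpos'⟩ := stub_exchange g l hlen hbal hnz hspanQ
  -- sorting over `ℚ` inside the Hurwitz orbit of `ratWord l'`, keeping the positive letters
  obtain ⟨P, N, hO, hP, hN, hcl⟩ :=
    Summit.SmoothPoincare4.SmoothPoincare4.Theorems.AcyclicBisectionExists.ModpBraidOrbits.SortBiSpan.exists_sorted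
      (stdSymp ℚ g') (ratWord l')
  -- lift the sorted word to the integral orbit
  obtain ⟨l'', hl'', hrat⟩ := hurwitzOrbit_lift (Int.castRingHom ℚ) g' l' (m := P ++ N)
    (by rwa [← ratWord_eq_mapWord])
  rw [← ratWord_eq_mapWord] at hrat
  have hsorted : Sorted l'' :=
    Sorted.of_mapWord (fun (v : Fin g' ⊕ Fin g' → ℤ) i => Int.castRingHom ℚ (v i))
      (by rw [← ratWord_eq_mapWord, hrat]; exact ⟨P, N, rfl, hP, hN⟩)
  have hposQ : Submodule.span ℚ (classesOfSign (ratWord l'') true) = ⊤ := by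
    rw [hrat]
    exact top_unique (hpos' ▸ Submodule.span_mono fun v hv =>
      List.mem_append_left N (hcl (v, true) hv rfl))
  have hreach'' : Reach g l g' l'' := hreach.trans_hurwitzOrbit hl''
  -- Stub 1 (realisation clause): Baykur's split `M = W₁ ∪_φ W₂`, one open book supporting both fields
  obtain ⟨W₁, _, _, _, _, W₂, _, _, _, _, S₁, S₂, b₁, b₂, φ, ob, α₁, α₂, hglue, hG₁, hG₂, hor, hconnW,
      hacyc₁, _⟩ := hreal g' l'' hreach'' hsorted hposQ
  -- Step GG: Giroux uniqueness + Gray on the seam `∂W₁` (tree theorems through the landed reduction)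
  haveI : T2Space W₁ := (hglue.isClosedGluing.choose_spec.choose_spec.1).isEmbedding.t2Space
  haveI : CompactSpace b₁.carrier := b₁.compactSpace_carrier
  haveI : T2Space b₁.carrier := b₁.isSmoothEmbedding.isEmbedding.t2Space
  obtain ⟨φ₁, hiso, hφ₁⟩ := stub_girouxGray_of Literature.Geometry.Symplectic.GirouxContactPath_holds
    Literature.Geometry.Symplectic.GrayStability_holds b₁.carrier ob _ _ α₁ α₂ hG₁ hG₂ hor
  -- Stub IR: `M` is also the `(φ₁ ≫ φ)`-gluing
  have hglue' := stub_isotopyRegluing M W₁ W₂ b₁ b₂ φ φ₁ hglue hiso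
  -- Stub CP: the new identification carries `ξ₁'` onto `contactPlane S₂.J`
  have hψ := stub_contactoPlanes W₁ W₂ S₁ S₂ b₁ b₂ φ φ₁ hφ₁
  -- Stub G: glue data ⇒ a witness of the crux with both halves ℚ-acyclic
  obtain ⟨W, hW⟩ := stub_glueWitness M e W₁ W₂ S₁ S₂ b₁ b₂ (φ₁.trans φ) hψ hglue' hconnW hacyc₁
  exact ⟨W.W₁, inferInstance, inferInstance, inferInstance, inferInstance, W.W₂, inferInstance,
    inferInstance, inferInstance, inferInstance, W.J₁, W.J₂, W.e₁, W.e₂, W.emb₁, W.emb₂, W.cover,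
    W.inter₁, W.inter₂, W.contact, hW⟩

end Summit.SmoothPoincare4.SmoothPoincare4.Cruxes.AcyclicBisectionExists.ModpBraidOrbits

end
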